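import Literature.MathematicalPhysics.QuantumFieldTheory.Balaban1983to89.B9Eq365RemainderKernel
import Literature.MathematicalPhysics.QuantumFieldTheory.Balaban1983to89.B9Thm34PKernelFinal

/-!
# `Balaban1983to89.B9Thm34PPrimeKernelFinal` — [Balaban1985BackgroundPropagators] THEOREM 3.4 p. 400 / p. 403, THE `R(U)`-CLAUSE: (3.68) FOR
# `P′(A) = P(U′U) − P(U)` IN THE PRINTED KERNEL FORM `[|P′(A;x,x′)|, |(∇P′(A))(x,x′)|, |(P′(A)∇*)(x,x′)|, |(∇P′(A)∇*)(x,x′)|] ≦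
# Kα₁[1, (Lʲη)⁻¹, (Lʲη)⁻¹, (Lʲη)⁻²](L^{j′}η)^{−d}e^{−(δ₀/4)d(y,y′)}` — FILE 33 of the Sect. B programme of cell `lit-balaban`, seat r06 (B9 fold owner)
# gen 16: the kernel-form twin of FILE 27 (`B9Thm34RFinal`, (3.68) as block majorants), and (§5) the `R(U)`-clause COMPLETE in kernel form

statement-level skeleton of published theorems with citation tags; proofs where landed; nothing here is a claim about the Yang–Mills mass gap

CITATION HEADER (lean-in-tree rule).  B9 = T. Bałaban, *Propagators for lattice gauge theories in a background field*, Commun. Math. Phys. **99** (1985)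
389–434 [Balaban1985BackgroundPropagators] (held `paper:balaban1985-cmp99-background-propagators`, journal page = PDF page + 388; text layer p0015 re-read
by this seat 2026-08-22).  Theorem 3.4 p. 400 [PDF 12, L7–10] «There exists a positive constant a₁ such that the operators G′(U), (Q′(U)G′²(U)Q′*(U))⁻¹,
R(U), G(U) extend to configurations U′U for α₁ ≦ a₁ as analytic functions of A. The extended operators satisfy all the inequalities of Theorems
3.1–3.3 correspondingly.»; p. 403 [PDF 15]: «These results imply that the operators R(U), P(U) = I − R(U) extend analytically to the domain (3.37) and
satisfy the same bounds, e.g. the operator P(U′U) satisfies the bounds (3.49). Moreover we have P(U′U) = P(U) + P′(A), |P′(A;x,x′)|, |(DP′(A))_μ(x,x′)|,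
|(P′(A)D*)_ν(x,x′)|, |(DP′(A)D*)_{μν}(x,x′)| ≦ O(1)α₁[1, (Lʲη)⁻¹, (Lʲη)⁻¹, (Lʲη)⁻²](L^{j′}η)^{−d}e^{−(1/2)δ₀d(y,y′)} for x ∈ Δ(y), y ∈ Λ_j, x′ ∈ Δ(y′),
y′ ∈ Λ_{j′}. (3.68) The remainder can be written explicitly in terms of the operators introduced until now by writing the expansions of the operators
determining P(U′U).» (the printed KERNEL shape = `B6RandomWalkKernel.HasKernelBound`, kernels for the pairing of p. 393, block volume weight
`v(y′) = (L^{j′}η)^d`); (3.25) p. 394 «P(U) = G′Q′*(Q′G′²Q′*)⁻¹Q′G′»; (3.49) p. 399; (3.57) p. 401, (3.59)–(3.67) pp. 402–403 (in particular (3.65)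
both forms, the p. 403 expansion defining `C′(A)`, (3.66), (3.67)); Theorem 3.1 (3.42) p. 397, Theorem 3.2 (3.48) p. 398, the p. 398 scale-transfer
remark, (3.19) p. 393, (3.37) p. 396.  [4] = [Balaban1984PropagatorsII] T. Bałaban, *Propagators and renormalization transformations for lattice gauge
theories. II*, Commun. Math. Phys. **96** (1984) 223–250: (2.51)–(2.55) p. 232, Lemma 2.1 p. 234, (2.66) p. 234, (2.68) p. 235.  Rows B9.Eq3.68 ×
B9.Thm3.4 × B9.Eq3.49 × B9.Eq3.66 (cells only; no head change).

WHAT IS PROVED (theorems only: 0 `def`, 0 sorry, 0 named facts; standard axioms).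
* §1 `hasMajorantHom_word349₂` — gen 11's word lemma `B9Ineq349Hom.hasMajorantHom_word349` (`X·Q′*·C·Q′·Y`, every letter between its own carriers)
  with TWO block-local norms (`Q′`-slot `κ`, `Q′*`-slot `κs`): majorant `κs·κ·B_XB₁B_YΛ⁴c²·w_X(Lʲη)⁻⁴w_Y·e^{−ρd}` — needed because the words of (3.68)
  put `F′₂*(A)` (norm `c_Fα₁`, (3.59)) next to `Q′(U′U)` (norm `κ_Q + c_Fα₁`, (3.57)).
* §2 `pPrime_five_words` — «by writing the expansions of the operators determining P(U′U)»: for all letters `X`, `Y`,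
  `X·P′(A)·Y = [X(E − G)·Q′*(U′U)·C⁻¹(U′U)·Q′(U′U)]·(E·Y) + [XG·F′₂*·C⁻¹(U′U)·Q′(U′U)]·(E·Y) + [XG·Q′*·(C⁻¹(U′U) − C⁻¹)·Q′(U′U)]·(E·Y)
  + [XG·Q′*·C⁻¹·F′₂]·(E·Y) + [XG·Q′*·C⁻¹·Q′]·((E − G)·Y)` (`G = G′(U)`, `E = G′(U′U)`, the brackets = compositions through 𝔅, the coarse letters read
  on the sites through an injective section `rep`) — `B9Eq360Vprime.pPrime_telescope` + `rep* ∘ rep_! = id`.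
* §3 `hasKernelBound_pPrime_words` — the abstract assembly: from block majorants of `X(E − G)` (factor `α₁`), `XG`, the block-local letters, `C⁻¹(U′U)`,
  `C⁻¹(U)`, `C⁻¹(U′U) − C⁻¹(U)` (factor `α₁`) and KERNEL bounds of `E·Y`, `(E − G)·Y` (factor `α₁`): `|(X·P′(A)·Y)(x,x′)| ≦ Kα₁·P(y)(Lʲη)⁻⁴w_Y(y)·
  e^{−ρ_kd}·v(y′)⁻¹` with an explicit `K` (§1 per prefix, FILE 22's `hasKernelBound_comp_decay` per word, `hasKernelBound_add`).
* §4 **`thm34_pPrime_kernel_final`** — hypotheses = FILE 30's `B9Thm34PKernelFinal.thm34_P_kernel_final` VERBATIM (Theorem 3.1 (3.42)₁₋₃ for `G′(U)`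
  as block majorants and (3.42)₁₋₄ as kernel bounds, the letter `Δ′_a(U)` with `G′(U)` its two-sided inverse, Theorem 3.2 for `U` ((3.21) `hLinv`,
  (3.48) `h348`), the (3.19) letters with a section `rep`, [4] Lemma 2.1 at `δ₀` for every exponent, the p. 398 scale transfer, the `A`-free (3.60)
  data); conclusion: `∃ a₁ > 0 ∃ K ≧ 0 ∀ α₁ ≦ a₁ ∀ A` in (3.37) (blockwise) `∀ kF sF ∀` (3.57)/(3.59) letters `Q′(U′U) = Q′ + F′₂`, `Q′*(U′U) = Q′* + F′₂*`
  (block-local, size `c_Fα₁`): THERE EXISTS `C⁻¹(U′U)`, two-sided inverse of `Q′(U′U)G′²(U′U)Q′*(U′U)` on 𝔅, such that `P(U′U) = P(U) + P′(A)` and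
  `P′(A) = B9Eq360Vprime.pPrime G′ G′(U′U) Q′* Q′*(U′U) C⁻¹ C⁻¹(U′U) Q′ Q′(U′U)` (read on the sites through `rep`, as in FILE 27) has the PRINTED KERNEL
  BOUNDS `|P′(A)(x,x′)| ≦ Kα₁e^{−(δ₀/4)d}v(y′)⁻¹`, `|(∇_kP′(A))(x,x′)|, |(P′(A)∇*_l)(x,x′)| ≦ Kα₁(Lʲη)⁻¹e^{−(δ₀/4)d}v⁻¹`, `|(∇_kP′(A)∇*_l)(x,x′)| ≦
  Kα₁(Lʲη)⁻²e^{−(δ₀/4)d}v⁻¹` — ONE `K`, independent of `α₁` and `A`.  PROOF (p. 403: «The remainder can be written explicitly in terms of the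
  operators G′(U), G′(U′U), V′, F′₂, C′ and it satisfies the bounds»; «using again Lemma 2.1», p. 399): the letters — `X·G′(U′U)` (FILE 26
  `thm34_Gp_final`), `X·(G′(U′U) − G′(U)) = (X·G′(U′U))·(V′(A)G′(U))` ((3.65); gen 9 `ineq363_op_vPrime` with `θ₃₆₃ ≦ K₁α₁` by continuity),
  `C⁻¹(U′U)` with (3.48) (FILE 26 `thm34_Cinv_final`), `C⁻¹(U)` with (3.48) (Theorem 3.2), `C⁻¹(U′U) − C⁻¹(U) = −C⁻¹(U′U)C′(A)C⁻¹(U)` ((3.67),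
  `inv_sub_inv_of_367`, `eq365b_hom`) with (3.66) for `C′(A)` (gen 10 `hasMajorant_cPrimeHom_vPrime`, `κ₃₆₆ ≦ K₆` by continuity) composed twice by
  [4] (2.52)/(2.55); the right letters `G′(U′U)·Y` (FILE 29 `thm34_Gp_kernel_final`) and `(G′(U′U) − G′(U))·Y` (FILE 32 `remainder365_kernel_final`)
  in KERNEL form; then §3 for each of the four entries; rates `17δ₀/50` (letters) → `3δ₀/10` (prefixes) → `δ₀/4` (kernels), exponents `1/100`.
* §5 **`thm34_R_kernel_final`** — THE `R(U)`-CLAUSE OF THEOREM 3.4 COMPLETE IN THE PRINTED KERNEL FORM, ONE STATEMENT: same hypotheses; `∃ a₁ > 0 ∃ K ≧ 0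
  ∀ α₁ ≦ a₁ ∀ A …`: there exists `C⁻¹(U′U)` (two-sided inverse) with `P(U′U) = P(U) + P′(A)`, the four (3.49) kernel bounds for `P(U′U)` (FILE 30,
  constant `K`) AND the four (3.68) kernel bounds for `P′(A)` (§4, constant `Kα₁`), all at the rate `δ₀/5` — FILE 30's and §4's `C⁻¹(U′U)` agree
  because a two-sided inverse is unique.

HONEST SCOPE / NOT CLAIMED.  (i) As in FILES 20–32: Theorems 3.1/3.2 FOR `U` are the INPUTS — the file certifies «Thms 3.1–3.2 for U ⇒ (3.68)/(3.49)
at U′U», not the bounds for a general background (row heads B9.Eq3.68 / B9.Eq3.49 / B9.Thm3.4 unchanged); (ii) the letters `∇`, `∇*` are the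
single-direction difference letters `conj b (diffLetter η⁻¹ k)` of (3.42)'s kernel hypotheses (FILES 25/29/30/32), the covariant derivatives of the
background `U` as printed in (3.68) (INTERFACES-r06 «two vocabularies»: FILE 27 uses the two-space gradient `conjHom b (gradLin …)`); (iii) the rate
`δ₀/4` (§4) / `δ₀/5` (§5) vs the printed `½δ₀` and the exponents `1/100` are ONE admissible bookkeeping of «the same bounds … with different
constants» (p. 403; each Lemma-2.1 composition of the cell's calculus costs a fixed fraction of the rate); (iv) `a₁`, `K` packaged existentially
AFTER the lattice is fixed (values depend on `d, L, δ₀, B_G, B₁, κ_Q, c_F, C_q, a₀, M₂Σ‖bᵢ‖, d₀` and the scale-transfer constants only); (v) the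
Hölder sentence after (3.49) is not treated (GAPS G-B9-02); (vi) (3.37) read blockwise in the shapes of FILES 1–32.  NOT summit progress.

RELATED IN THE TREE, NOT DUPLICATED (searched 2026-08-22: `lean search 'pPrime_kernel|R_kernel_final|word349₂|pPrime_five_words|hasKernelBound_pPrime'`
= ∅): FILE 27 `B9Thm34RFinal` ((3.68)/(3.49) as block majorants, two-space gradient letters), FILE 30 `B9Thm34PKernelFinal.thm34_P_kernel_final`
((3.49) for `P(U′U)` in kernel form — USED BY NAME in §5), FILE 32 `B9Eq365RemainderKernel.remainder365_kernel_final`, FILE 29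
`B9Thm34GpKernelFinal.thm34_Gp_kernel_final`, FILE 26 `B9Thm34SectBFinal.thm34_Gp_final`/`thm34_Cinv_final`, FILE 22 `B9Ineq385Kernel`, gen 11
`B9Ineq349Hom` (§1 calculus; `hasMajorantHom_word349` is the one-κ case of §1), gen 9 `B9Ineq363Vprime.ineq363_op_vPrime`, gen 10
`B9Ineq366Vprime` (`eq365b_hom`, `hasMajorant_cPrimeHom_vPrime`), gen 6 `B9Ineq366CPrime` (one-space composition calculus), `B9Eq360Vprime`
(`pOp`, `pPrime`, `eq368`, `pPrime_telescope`, `inv_sub_inv_of_367`), FILE 17 `B6RandomWalkSection` — all USED BY NAME.  Binder blocks extracted from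
the tree copy of FILE 30 by line range (generator `lit-balaban-r06/lean/gen33.py`), no hand-typed signatures.
-/

noncomputable section

namespace Literature.MathematicalPhysics.QuantumFieldTheory.Balaban1983to89.B9Thm34PPrimeKernelFinal

open NormedSpace Complex
open Literature.MathematicalPhysics.QuantumFieldTheory.Balaban1983to89
open Literature.MathematicalPhysics.QuantumFieldTheory.Balaban1983to89.B6RandomWalk (HasMajorant hasMajorant_mono Triangle254 Ineq261)
open Literature.MathematicalPhysics.QuantumFieldTheory.Balaban1983to89.B6RandomWalkHom (HasMajorantHom hasMajorantHom_mono hasMajorantHom_iff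
  hasMajorantHom_add)
open Literature.MathematicalPhysics.QuantumFieldTheory.Balaban1983to89.B6RandomWalkKernel (HasKernelBound hasKernelBound_mono hasKernelBound_add)
open Literature.MathematicalPhysics.QuantumFieldTheory.Balaban1983to89.B9Thm34Ext (toB6)
open Literature.MathematicalPhysics.QuantumFieldTheory.Balaban1983to89.B9Ineq347 (ScaleTransfer)
open Literature.MathematicalPhysics.QuantumFieldTheory.Balaban1983to89.B9Ineq349Hom (hasMajorantHom_rate_mono hasMajorantHom_comp_decay
  hasMajorantHom_local_comp)
open Literature.MathematicalPhysics.QuantumFieldTheory.Balaban1983to89.B9Ineq366CPrime (hasMajorant_rate_mono hasMajorant_comp_decay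
  hasMajorant_comp_decay_right1 cPrimeHom kappa366)
open Literature.MathematicalPhysics.QuantumFieldTheory.Balaban1983to89.B9Ineq368PPrime (hasMajorant_neg transfers_word)
open Literature.MathematicalPhysics.QuantumFieldTheory.Balaban1983to89.B9Ineq385VG (kappa385 kappa385_nonneg)
open Literature.MathematicalPhysics.QuantumFieldTheory.Balaban1983to89.B9Ineq385Kernel (hasKernelBound_rate_mono hasKernelBound_comp_decay)
open Literature.MathematicalPhysics.QuantumFieldTheory.Balaban1983to89.B9Ineq385KernelConcrete (eq386_resolvent_of_inverses)
open Literature.MathematicalPhysics.QuantumFieldTheory.Balaban1983to89.B9Eq39Adjoint (covD covDstar)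
open Literature.MathematicalPhysics.QuantumFieldTheory.Balaban1983to89.B9Eq352DivForm (tauB)
open Literature.MathematicalPhysics.QuantumFieldTheory.Balaban1983to89.B9Eq352DivFormLetters (conj)
open Literature.MathematicalPhysics.QuantumFieldTheory.Balaban1983to89.B9Eq352GradLetters (diffLetter)
open Literature.MathematicalPhysics.QuantumFieldTheory.Balaban1983to89.B9Eq360Vprime (gPrimeExtEnd pOp pPrime eq368 pPrime_telescope
  inv_sub_inv_of_367)
open Literature.MathematicalPhysics.QuantumFieldTheory.Balaban1983to89.B9Eq360VprimeLetters (vPrimeConc cBConc)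
open Literature.MathematicalPhysics.QuantumFieldTheory.Balaban1983to89.B9Ineq363Vprime (cVConc cVConc_nonneg theta363 theta363_nonneg
  ineq363_op_vPrime)
open Literature.MathematicalPhysics.QuantumFieldTheory.Balaban1983to89.B9Ineq366Vprime (eq365b_hom hasMajorant_cPrimeHom_vPrime)
open Literature.MathematicalPhysics.QuantumFieldTheory.Balaban1983to89.B6RandomWalkSection (secExt secRes secConj secConj_def secRes_secExt_apply
  hasMajorant_id_of_ker)
open Literature.MathematicalPhysics.QuantumFieldTheory.Balaban1983to89.B9Thm34GFinal (ineq261_rescale c1_pos_of_ineq261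
  exists_threshold_of_continuousAt)
open Literature.MathematicalPhysics.QuantumFieldTheory.Balaban1983to89.B9Thm34GKernelFinal (exists_bound_of_continuousAt)
open Literature.MathematicalPhysics.QuantumFieldTheory.Balaban1983to89.B9Thm34SectBFinal (thm34_Gp_final thm34_Cinv_final)
open Literature.MathematicalPhysics.QuantumFieldTheory.Balaban1983to89.B9Thm34GpKernelFinal (thm34_Gp_kernel_final)
open Literature.MathematicalPhysics.QuantumFieldTheory.Balaban1983to89.B9Eq365RemainderKernel (remainder365_kernel_final)
open Literature.MathematicalPhysics.QuantumFieldTheory.Balaban1983to89.B9Thm34PKernelFinal (thm34_P_kernel_final)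

/-! ## §1  The word `X·Q′*·C·Q′·Y` of (3.25)/(3.68) with every letter between its own carriers and TWO block-local norms -/

section Word

variable {g : B9.Geometry} [Fintype g.Site] [DecidableEq g.Site] {R : ℝ} {H : Prop} {I O X Z : Type}

/-- **The word `X·Q′*·C·Q′·Y` with generic end letters, the `Q′`-slot and the `Q′*`-slot carrying DIFFERENT block-local norms** (the
five one-difference words of (3.68) need `Q′(U′U)` of norm `κ_Q + c_Fα₁` next to `F′₂*(A)` of norm `c_Fα₁`, (3.57)/(3.59)): `Y : (I → ℝ) → (X → ℝ)`
with majorant `B_Y w_Y e^{−δ d}`, `Q′ : (X → ℝ) → (Z → ℝ)` block-local with norm `κ`, `Q′* : (Z → ℝ) → (X → ℝ)` block-local with norm `κs`,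
`C` on the coarse lattice with the (3.48)/(3.67)-shape majorant `B₁(Lʲη)⁻⁴e^{−δ d}`, `X : (X → ℝ) → (O → ℝ)` with `B_X w_X e^{−δ d}`: the word
has the majorant `κs·κ·B_XB₁B_Y Λ⁴c² · w_X(Lʲη)⁻⁴w_Y · e^{−ρ d}` for `ρ + (2α+β)δ₀ ≦ δ` — gen 11's `B9Ineq349Hom.hasMajorantHom_word349` is the
case `κs = κ` (*"using again Lemma 2.1"*, p. 399; [4] (2.52)–(2.55), the y″-sum of (2.68)).
[cite: Balaban1985BackgroundPropagators, (3.25) p.394 + (3.19) p.393 + (3.48) p.398 + (3.49) p.399 + (3.57) p.401 + (3.59) p.402 + (3.68) p.403; Balaban1984PropagatorsII, Lemma 2.1 p.234 + (2.52)–(2.55) p.232 + (2.68) p.235] -/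
theorem hasMajorantHom_word349₂ (blkI : I → g.Site) (blkO : O → g.Site) (blkX : X → g.Site) (blkZ : Z → g.Site) (d : ℕ)
    (δ₀ δ α β ρ Λ κ κs BX B₁ BY : ℝ) (wX wY : g.Site → ℝ)
    (hwX : ∀ a, 0 ≤ wX a) (hwY : ∀ a, 0 ≤ wY a) (hκ : 0 ≤ κ) (hκs : 0 ≤ κs) (hBX : 0 ≤ BX) (hB₁ : 0 ≤ B₁) (hBY : 0 ≤ BY)
    (hΛ : 1 ≤ Λ) (hρ : 0 ≤ ρ) (hα : 0 ≤ α) (hβ : 0 ≤ β) (hδ₀ : 0 ≤ δ₀) (hr : ρ + (2 * α + β) * δ₀ ≤ δ)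
    (hdnn : ∀ a b : g.Site, 0 ≤ g.dist a b) (htri : Triangle254 (toB6 g R H))
    (h261 : Ineq261 d (toB6 g R H) δ₀ β)
    (hTY : ScaleTransfer g δ₀ α Λ wY) (hT4 : ScaleTransfer g δ₀ α Λ (fun a => (g.len a ^ 4)⁻¹))
    {Xl : (X → ℝ) →ₗ[ℝ] (O → ℝ)} {Yl : (I → ℝ) →ₗ[ℝ] (X → ℝ)} {Q : (X → ℝ) →ₗ[ℝ] (Z → ℝ)}
    {Qs : (Z → ℝ) →ₗ[ℝ] (X → ℝ)} {Cinv : Module.End ℝ (Z → ℝ)}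
    (hX : HasMajorantHom (g := toB6 g R H) blkX blkO Xl (fun a b => BX * wX a * Real.exp (-(δ * g.dist a b))))
    (hY : HasMajorantHom (g := toB6 g R H) blkI blkX Yl (fun a b => BY * wY a * Real.exp (-(δ * g.dist a b))))
    (hQ : HasMajorantHom (g := toB6 g R H) blkX blkZ Q (fun a b : g.Site => if a = b then κ else 0))
    (hQs : HasMajorantHom (g := toB6 g R H) blkZ blkX Qs (fun a b : g.Site => if a = b then κs else 0))
    (hCinv : HasMajorant (g := toB6 g R H) blkZ Cinv (fun a b => B₁ * (g.len a ^ 4)⁻¹ * Real.exp (-(δ * g.dist a b)))) :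
    HasMajorantHom (g := toB6 g R H) blkI blkO (Xl ∘ₗ Qs ∘ₗ Cinv ∘ₗ Q ∘ₗ Yl)
      (fun a b => (κs * κ * BX * B₁ * BY * Λ ^ 4 * B6.c1 d δ₀ β ^ 2) * (wX a * ((g.len a ^ 4)⁻¹ * wY a)) *
        Real.exp (-(ρ * g.dist a b))) := by
  have hc0 : 0 ≤ B6.c1 d δ₀ β := B6RandomWalk.c1_nonneg d δ₀ β
  have hΛ0 : 0 ≤ Λ := zero_le_one.trans hΛ
  have hw4 : ∀ a : g.Site, 0 ≤ (g.len a ^ 4)⁻¹ := fun a => inv_nonneg.mpr (by positivity)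
  have hw4Y : ∀ a : g.Site, 0 ≤ (g.len a ^ 4)⁻¹ * wY a := fun a => mul_nonneg (hw4 a) (hwY a)
  have hρδ : ρ ≤ δ := by nlinarith
  obtain ⟨tY, t4Y⟩ := transfers_word (g := g) hwY hΛ hα hδ₀ hdnn hTY hT4
  -- the right end letter at the output rate ρ
  have hYρ : HasMajorantHom (g := toB6 g R H) blkI blkX Yl (fun a b => BY * wY a * Real.exp (-(ρ * g.dist a b))) :=
    hasMajorantHom_rate_mono (R := R) (H := H) blkI blkX BY wY hBY hwY hρδ hdnn hY
  have hKY : ∀ a b : g.Site, 0 ≤ BY * wY a * Real.exp (-(ρ * g.dist a b)) := fun a b => by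
    have := hwY a; positivity
  -- Q′·Y (the `Q′`-slot, norm `κ`)
  have s1 : HasMajorantHom (g := toB6 g R H) blkI blkZ (Q ∘ₗ Yl)
      (fun a b => (κ * BY) * wY a * Real.exp (-(ρ * g.dist a b))) :=
    hasMajorantHom_mono (g := toB6 g R H) blkI blkZ
      (hasMajorantHom_local_comp (R := R) (H := H) blkI blkX blkZ κ hKY hQ hYρ) fun a b => le_of_eq (by ring)
  -- C·(Q′·Y)
  have hCinv' : HasMajorantHom (g := toB6 g R H) blkZ blkZ Cinv
      (fun a b => B₁ * (g.len a ^ 4)⁻¹ * Real.exp (-(δ * g.dist a b))) :=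
    (hasMajorantHom_iff (g := toB6 g R H) blkZ Cinv _).mpr hCinv
  have s2 : HasMajorantHom (g := toB6 g R H) blkI blkZ (Cinv ∘ₗ (Q ∘ₗ Yl))
      (fun a b => (B₁ * (κ * BY) * Λ ^ 2 * B6.c1 d δ₀ β) * ((g.len a ^ 4)⁻¹ * wY a) *
        Real.exp (-(ρ * g.dist a b))) :=
    hasMajorantHom_comp_decay (R := R) (H := H) blkI blkZ blkZ d δ₀ (2 * α) β ρ δ (Λ ^ 2) B₁ (κ * BY)
      (fun a => (g.len a ^ 4)⁻¹) wY hw4 hwY (by positivity) hB₁ (mul_nonneg hκ hBY) hρ hr hdnn htri tY h261 hCinv' s1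
  have hK2 : ∀ a b : g.Site, 0 ≤ (B₁ * (κ * BY) * Λ ^ 2 * B6.c1 d δ₀ β) * ((g.len a ^ 4)⁻¹ * wY a) *
      Real.exp (-(ρ * g.dist a b)) := fun a b => by
    have := hw4Y a; positivity
  -- Q′*·(C·(Q′·Y)) (the `Q′*`-slot, norm `κs`)
  have s3 : HasMajorantHom (g := toB6 g R H) blkI blkX (Qs ∘ₗ (Cinv ∘ₗ (Q ∘ₗ Yl)))
      (fun a b => (κs * (B₁ * (κ * BY) * Λ ^ 2 * B6.c1 d δ₀ β)) * ((g.len a ^ 4)⁻¹ * wY a) *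
        Real.exp (-(ρ * g.dist a b))) :=
    hasMajorantHom_mono (g := toB6 g R H) blkI blkX
      (hasMajorantHom_local_comp (R := R) (H := H) blkI blkZ blkX κs hK2 hQs s2) fun a b => le_of_eq (by ring)
  -- X·(Q′*·(C·(Q′·Y)))
  have s4 : HasMajorantHom (g := toB6 g R H) blkI blkO (Xl ∘ₗ (Qs ∘ₗ (Cinv ∘ₗ (Q ∘ₗ Yl))))
      (fun a b => (BX * (κs * (B₁ * (κ * BY) * Λ ^ 2 * B6.c1 d δ₀ β)) * Λ ^ 2 * B6.c1 d δ₀ β) *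
        (wX a * ((g.len a ^ 4)⁻¹ * wY a)) * Real.exp (-(ρ * g.dist a b))) :=
    hasMajorantHom_comp_decay (R := R) (H := H) blkI blkX blkO d δ₀ (2 * α) β ρ δ (Λ ^ 2) BX
      (κs * (B₁ * (κ * BY) * Λ ^ 2 * B6.c1 d δ₀ β)) wX (fun a => (g.len a ^ 4)⁻¹ * wY a) hwX hw4Y (by positivity) hBX
      (by positivity) hρ hr hdnn htri t4Y h261 hX s3
  exact hasMajorantHom_mono (g := toB6 g R H) blkI blkO s4 fun a b => le_of_eq (by ring)

end Word

/-! ## §2  (3.68) «The remainder can be written explicitly in terms of the operators introduced until now by writing the expansions of the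
operators determining P(U′U)»: `X·P′(A)·Y` IS the sum of five words `(prefix through 𝔅)·(right letter)`, each prefix carrying ONE difference
letter ((3.57) `F′₂ = Q′(U′U) − Q′(U)`, `F′₂*`, (3.67) `C⁻¹(U′U) − C⁻¹(U)`, (3.65) `G′(U′U) − G′(U)`) -/

section Algebra

variable {W Z : Type}

/-- **The five one-difference words of `P′(A) = P(U′U) − P(U)`, bracketed for the kernel step**: with the coarse letters read on the sites through an
injective section `rep` (`Q′* = Qcs ∘ rep*`, `Q′ = rep_! ∘ Qc`, `C⁻¹ = rep_! C⁻¹ rep*`, FILE 17) and (3.57) `Q′(U′U) = Q′ + F′₂`, `Q′*(U′U) = Q′* + F′₂*`,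
for all letters `X`, `Y`: `X·P′(A)·Y = [X(E − G)·Q′*(U′U)·C⁻¹(U′U)·Q′(U′U)]·(E·Y) + [XG·F′₂*·C⁻¹(U′U)·Q′(U′U)]·(E·Y) + [XG·Q′*·(C⁻¹(U′U) − C⁻¹)·Q′(U′U)]·(E·Y)
+ [XG·Q′*·C⁻¹·F′₂]·(E·Y) + [XG·Q′*·C⁻¹·Q′]·((E − G)·Y)` (`G = G′(U)`, `E = G′(U′U)`; the brackets are compositions through 𝔅) —
`B9Eq360Vprime.pPrime_telescope` + `rep* ∘ rep_! = id`. [cite: Balaban1985BackgroundPropagators, (3.68) p.403 + (3.25) p.394 + (3.57) p.401 + (3.65)–(3.67) pp.402–403] -/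
theorem pPrime_five_words {rep : Z → W} (hinj : Function.Injective rep) (G E X Y : Module.End ℝ (W → ℝ))
    (Qc Qc' Fc : (W → ℝ) →ₗ[ℝ] (Z → ℝ)) (Qcs Qcs' Fcs : (Z → ℝ) →ₗ[ℝ] (W → ℝ)) (Linv Tinv : Module.End ℝ (Z → ℝ))
    (h357 : Qc' = Qc + Fc) (h357s : Qcs' = Qcs + Fcs) :
    X * pPrime G E (Qcs ∘ₗ secRes rep) (Qcs' ∘ₗ secRes rep) (secConj rep Linv) (secConj rep Tinv)
        (secExt rep ∘ₗ Qc) (secExt rep ∘ₗ Qc') * Y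
      = ((X * (E - G)) ∘ₗ Qcs' ∘ₗ Tinv ∘ₗ Qc' ∘ₗ (1 : Module.End ℝ (W → ℝ))) * (E * Y)
        + ((X * G) ∘ₗ Fcs ∘ₗ Tinv ∘ₗ Qc' ∘ₗ (1 : Module.End ℝ (W → ℝ))) * (E * Y)
        + ((X * G) ∘ₗ Qcs ∘ₗ (Tinv - Linv) ∘ₗ Qc' ∘ₗ (1 : Module.End ℝ (W → ℝ))) * (E * Y)
        + ((X * G) ∘ₗ Qcs ∘ₗ Linv ∘ₗ Fc ∘ₗ (1 : Module.End ℝ (W → ℝ))) * (E * Y)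
        + ((X * G) ∘ₗ Qcs ∘ₗ Linv ∘ₗ Qc ∘ₗ (1 : Module.End ℝ (W → ℝ))) * ((E - G) * Y) := by
  have hF : Fc = Qc' - Qc := by rw [h357]; abel
  have hFs : Fcs = Qcs' - Qcs := by rw [h357s]; abel
  rw [hF, hFs, pPrime_telescope]
  refine LinearMap.ext fun f => ?_
  simp only [Module.End.mul_apply, LinearMap.add_apply, LinearMap.sub_apply, LinearMap.comp_apply, Module.End.one_apply,
    secConj_def, secRes_secExt_apply hinj, map_add, map_sub]

end Algebra

/-! ## §3  The five words in the printed kernel form: block-majorant prefix × kernel right letter ([4] (2.52)/(2.55) + Lemma 2.1; the factor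
`(L^{j′}η)^{−d}` rides on the right letter) -/

section Assembly

variable {g : B9.Geometry} [Fintype g.Site] [DecidableEq g.Site] {R : ℝ} {H : Prop} {W Z : Type} [Fintype W] [DecidableEq W]

set_option maxHeartbeats 800000 in
/-- **(3.68) FOR `X·P′(A)·Y` IN THE PRINTED KERNEL FORM, FROM LETTER BOUNDS** («The remainder can be written explicitly … and it satisfies the
bounds», p. 403): given block majorants (rate `δ_w`) of the left letters `X(E − G) ≺ B_{Xd}α₁P e^{−δ_wd}` ((3.65) with (3.63): the factor `α₁`),
`XG ≺ B_XP e^{−δ_wd}` ((3.42)), block-local `Q′, Q′*` (norm `κ`), `Q′(U′U), Q′*(U′U)` (norm `κ′`), `F′₂, F′₂*` (norm `φα₁`, (3.59)), the coarse letters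
`C⁻¹(U′U) ≺ B_T(Lʲη)⁻⁴e^{−δ_wd}`, `C⁻¹(U) ≺ B_L(Lʲη)⁻⁴e^{−δ_wd}` ((3.48)), `C⁻¹(U′U) − C⁻¹(U) ≺ B_{TL}α₁(Lʲη)⁻⁴e^{−δ_wd}` ((3.66)–(3.67)), and KERNEL
bounds (rate `ρ_k`) of the right letters `|(E·Y)(x,x′)| ≦ B_Ew_Y(y)e^{−ρ_kd}v(y′)⁻¹` ((3.42) for `G′(U′U)`), `|((E − G)·Y)(x,x′)| ≦ B_Rα₁w_Ye^{−ρ_kd}v⁻¹`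
(p. 403 l. 7–9), with `ρ_w + (2α+β)δ₀ ≦ δ_w`, `ρ_k + (α+β)δ₀ ≦ ρ_w`, the scale transfers of `w_Y`, `(Lʲη)⁻⁴` at `α` and (2.61) at `β`:
`|(X·P′(A)·Y)(x,x′)| ≦ K·α₁·P(y)(Lʲη)⁻⁴w_Y(y)·e^{−ρ_kd(y,y′)}·v(y′)⁻¹` with the explicit
`K = ((κ′²B_{Xd}B_T + φκ′B_XB_T + κκ′B_XB_{TL} + κφB_XB_L)B_E + κ²B_XB_LB_R)Λ⁴c²·Λc` — §2's five words, §1 for each prefix, FILE 22's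
`hasKernelBound_comp_decay` for each product, `hasKernelBound_add`.
[cite: Balaban1985BackgroundPropagators, (3.68) p.403 + (3.49) p.399 + (3.25) p.394 + (3.42) p.397 + (3.48) p.398 + (3.57) p.401 + (3.59)–(3.67) pp.402–403; Balaban1984PropagatorsII, Lemma 2.1 p.234 + (2.51)–(2.55) p.232 + (2.68) p.235] -/
theorem hasKernelBound_pPrime_words (blkW : W → g.Site) (blkZ : Z → g.Site) {rep : Z → W} (hinj : Function.Injective rep)
    (d : ℕ) (δ₀ α β δw ρw ρk Λ κ κ' φ BX BXd BT BL BTL BE BR α₁ : ℝ) (P wY : g.Site → ℝ)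
    (hP : ∀ a, 0 ≤ P a) (hwY : ∀ a, 0 ≤ wY a) (hκ : 0 ≤ κ) (hκ' : 0 ≤ κ') (hφ : 0 ≤ φ) (hBX : 0 ≤ BX) (hBXd : 0 ≤ BXd)
    (hBT : 0 ≤ BT) (hBL : 0 ≤ BL) (hBTL : 0 ≤ BTL) (hBE : 0 ≤ BE) (hBR : 0 ≤ BR) (hα₁ : 0 ≤ α₁) (hΛ : 1 ≤ Λ)
    (hρw : 0 ≤ ρw) (hρk : 0 ≤ ρk) (hα : 0 ≤ α) (hβ : 0 ≤ β) (hδ₀ : 0 ≤ δ₀)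
    (hrw : ρw + (2 * α + β) * δ₀ ≤ δw) (hrk : ρk + (α + β) * δ₀ ≤ ρw)
    (hdnn : ∀ a b : g.Site, 0 ≤ g.dist a b) (htri : Triangle254 (toB6 g R H)) (hrefl : ∀ y : g.Site, g.dist y y = 0)
    (h261 : Ineq261 d (toB6 g R H) δ₀ β)
    (hTY : ScaleTransfer g δ₀ α Λ wY) (hT4 : ScaleTransfer g δ₀ α Λ (fun a => (g.len a ^ 4)⁻¹))
    {v : g.Site → ℝ} (hv : ∀ y, 0 < v y) {cK : ℝ} (hcK : 0 < cK)
    {G E X Y : Module.End ℝ (W → ℝ)} {Qc Qc' Fc : (W → ℝ) →ₗ[ℝ] (Z → ℝ)} {Qcs Qcs' Fcs : (Z → ℝ) →ₗ[ℝ] (W → ℝ)}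
    {Linv Tinv : Module.End ℝ (Z → ℝ)} (h357 : Qc' = Qc + Fc) (h357s : Qcs' = Qcs + Fcs)
    (hXd : HasMajorant (g := toB6 g R H) blkW (X * (E - G)) (fun a b => BXd * α₁ * P a * Real.exp (-(δw * g.dist a b))))
    (hXG : HasMajorant (g := toB6 g R H) blkW (X * G) (fun a b => BX * P a * Real.exp (-(δw * g.dist a b))))
    (hQc : HasMajorantHom (g := toB6 g R H) blkW blkZ Qc (fun a b : g.Site => if a = b then κ else 0))
    (hQcs : HasMajorantHom (g := toB6 g R H) blkZ blkW Qcs (fun a b : g.Site => if a = b then κ else 0))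
    (hQc' : HasMajorantHom (g := toB6 g R H) blkW blkZ Qc' (fun a b : g.Site => if a = b then κ' else 0))
    (hQcs' : HasMajorantHom (g := toB6 g R H) blkZ blkW Qcs' (fun a b : g.Site => if a = b then κ' else 0))
    (hFc : HasMajorantHom (g := toB6 g R H) blkW blkZ Fc (fun a b : g.Site => if a = b then φ * α₁ else 0))
    (hFcs : HasMajorantHom (g := toB6 g R H) blkZ blkW Fcs (fun a b : g.Site => if a = b then φ * α₁ else 0))
    (hT : HasMajorant (g := toB6 g R H) blkZ Tinv (fun a b => BT * (g.len a ^ 4)⁻¹ * Real.exp (-(δw * g.dist a b))))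
    (hLi : HasMajorant (g := toB6 g R H) blkZ Linv (fun a b => BL * (g.len a ^ 4)⁻¹ * Real.exp (-(δw * g.dist a b))))
    (hTL : HasMajorant (g := toB6 g R H) blkZ (Tinv - Linv)
      (fun a b => BTL * α₁ * (g.len a ^ 4)⁻¹ * Real.exp (-(δw * g.dist a b))))
    (hEY : HasKernelBound (g := toB6 g R H) blkW v cK (E * Y) (fun a b => BE * wY a * Real.exp (-(ρk * g.dist a b))))
    (hRY : HasKernelBound (g := toB6 g R H) blkW v cK ((E - G) * Y)
      (fun a b => BR * α₁ * wY a * Real.exp (-(ρk * g.dist a b)))) :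
    HasKernelBound (g := toB6 g R H) blkW v cK
      (X * pPrime G E (Qcs ∘ₗ secRes rep) (Qcs' ∘ₗ secRes rep) (secConj rep Linv) (secConj rep Tinv)
        (secExt rep ∘ₗ Qc) (secExt rep ∘ₗ Qc') * Y)
      (fun a b => ((κ' * κ' * BXd * BT + φ * κ' * BX * BT + κ * κ' * BX * BTL + κ * φ * BX * BL) * BE
          + κ * κ * BX * BL * BR) * Λ ^ 4 * B6.c1 d δ₀ β ^ 2 * Λ * B6.c1 d δ₀ β * α₁ *
        (P a * (g.len a ^ 4)⁻¹ * wY a) * Real.exp (-(ρk * g.dist a b))) := by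
  have hc : 0 ≤ B6.c1 d δ₀ β := B6RandomWalk.c1_nonneg d δ₀ β
  have hΛ0 : 0 ≤ Λ := zero_le_one.trans hΛ
  have hφα : 0 ≤ φ * α₁ := mul_nonneg hφ hα₁
  have hBXdα : 0 ≤ BXd * α₁ := mul_nonneg hBXd hα₁
  have hBTLα : 0 ≤ BTL * α₁ := mul_nonneg hBTL hα₁
  have hBRα : 0 ≤ BR * α₁ := mul_nonneg hBR hα₁
  -- the end letters as two-space majorants; the identity right end of the prefix words (`d(y,y) = 0`); the free transfer of the weight `1`
  have hXd' : HasMajorantHom (g := toB6 g R H) blkW blkW (X * (E - G))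
      (fun a b => (BXd * α₁) * P a * Real.exp (-(δw * g.dist a b))) :=
    (hasMajorantHom_iff (g := toB6 g R H) _ _ _).mpr hXd
  have hXG' : HasMajorantHom (g := toB6 g R H) blkW blkW (X * G)
      (fun a b => BX * P a * Real.exp (-(δw * g.dist a b))) :=
    (hasMajorantHom_iff (g := toB6 g R H) _ _ _).mpr hXG
  have hY1 : HasMajorantHom (g := toB6 g R H) blkW blkW (1 : Module.End ℝ (W → ℝ))
      (fun a b => (1 : ℝ) * (fun _ : g.Site => (1 : ℝ)) a * Real.exp (-(δw * g.dist a b))) := by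
    intro y' μ Bμ hμ x
    rw [Module.End.one_apply]
    dsimp only
    by_cases hx : blkW x = y'
    · rw [hx, hrefl, mul_zero, neg_zero, Real.exp_zero]
      simpa using hμ.bound x hx
    · rw [hμ.off x hx, abs_zero]
      exact mul_nonneg (by positivity) hμ.nonneg
  have hSTone : ScaleTransfer g δ₀ α Λ (fun _ : g.Site => (1 : ℝ)) := fun y y' => by
    simp only [mul_one]
    have h0 : 0 ≤ α * δ₀ * g.dist y y' := mul_nonneg (mul_nonneg hα hδ₀) (hdnn y y')
    exact (Real.exp_le_one_iff.mpr (by linarith)).trans hΛ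
  -- the five prefix words through 𝔅 (§1)
  have hW1 := hasMajorantHom_word349₂ (R := R) (H := H) blkW blkW blkW blkZ d δ₀ δw α β ρw Λ κ' κ' (BXd * α₁) BT 1
    P (fun _ => (1 : ℝ)) hP (fun _ => zero_le_one) hκ' hκ' hBXdα hBT zero_le_one hΛ hρw hα hβ hδ₀ hrw hdnn htri h261
    hSTone hT4 hXd' hY1 hQc' hQcs' hT
  have hW2 := hasMajorantHom_word349₂ (R := R) (H := H) blkW blkW blkW blkZ d δ₀ δw α β ρw Λ κ' (φ * α₁) BX BT 1
    P (fun _ => (1 : ℝ)) hP (fun _ => zero_le_one) hκ' hφα hBX hBT zero_le_one hΛ hρw hα hβ hδ₀ hrw hdnn htri h261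
    hSTone hT4 hXG' hY1 hQc' hFcs hT
  have hW3 := hasMajorantHom_word349₂ (R := R) (H := H) blkW blkW blkW blkZ d δ₀ δw α β ρw Λ κ' κ BX (BTL * α₁) 1
    P (fun _ => (1 : ℝ)) hP (fun _ => zero_le_one) hκ' hκ hBX hBTLα zero_le_one hΛ hρw hα hβ hδ₀ hrw hdnn htri h261
    hSTone hT4 hXG' hY1 hQc' hQcs hTL
  have hW4 := hasMajorantHom_word349₂ (R := R) (H := H) blkW blkW blkW blkZ d δ₀ δw α β ρw Λ (φ * α₁) κ BX BL 1
    P (fun _ => (1 : ℝ)) hP (fun _ => zero_le_one) hφα hκ hBX hBL zero_le_one hΛ hρw hα hβ hδ₀ hrw hdnn htri h261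
    hSTone hT4 hXG' hY1 hFc hQcs hLi
  have hW5 := hasMajorantHom_word349₂ (R := R) (H := H) blkW blkW blkW blkZ d δ₀ δw α β ρw Λ κ κ BX BL 1
    P (fun _ => (1 : ℝ)) hP (fun _ => zero_le_one) hκ hκ hBX hBL zero_le_one hΛ hρw hα hβ hδ₀ hrw hdnn htri h261
    hSTone hT4 hXG' hY1 hQc hQcs hLi
  -- the five kernel words: prefix × right letter
  have hw₁ : ∀ a : g.Site, 0 ≤ P a * ((g.len a ^ 4)⁻¹ * 1) := fun a =>
    mul_nonneg (hP a) (mul_nonneg (inv_nonneg.mpr (by positivity)) zero_le_one)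
  have k1 := hasKernelBound_comp_decay (R := R) (H := H) blkW d δ₀ α β ρk ρw Λ
    (κ' * κ' * (BXd * α₁) * BT * 1 * Λ ^ 4 * B6.c1 d δ₀ β ^ 2) BE (fun a => P a * ((g.len a ^ 4)⁻¹ * 1)) wY hw₁ hwY hΛ0
    (by positivity) hBE hρk hrk hdnn htri hTY h261 hv hcK ((hasMajorantHom_iff (g := toB6 g R H) _ _ _).mp hW1) hEY
  have k2 := hasKernelBound_comp_decay (R := R) (H := H) blkW d δ₀ α β ρk ρw Λ
    (φ * α₁ * κ' * BX * BT * 1 * Λ ^ 4 * B6.c1 d δ₀ β ^ 2) BE (fun a => P a * ((g.len a ^ 4)⁻¹ * 1)) wY hw₁ hwY hΛ0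
    (by positivity) hBE hρk hrk hdnn htri hTY h261 hv hcK ((hasMajorantHom_iff (g := toB6 g R H) _ _ _).mp hW2) hEY
  have k3 := hasKernelBound_comp_decay (R := R) (H := H) blkW d δ₀ α β ρk ρw Λ
    (κ * κ' * BX * (BTL * α₁) * 1 * Λ ^ 4 * B6.c1 d δ₀ β ^ 2) BE (fun a => P a * ((g.len a ^ 4)⁻¹ * 1)) wY hw₁ hwY hΛ0
    (by positivity) hBE hρk hrk hdnn htri hTY h261 hv hcK ((hasMajorantHom_iff (g := toB6 g R H) _ _ _).mp hW3) hEY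
  have k4 := hasKernelBound_comp_decay (R := R) (H := H) blkW d δ₀ α β ρk ρw Λ
    (κ * (φ * α₁) * BX * BL * 1 * Λ ^ 4 * B6.c1 d δ₀ β ^ 2) BE (fun a => P a * ((g.len a ^ 4)⁻¹ * 1)) wY hw₁ hwY hΛ0
    (by positivity) hBE hρk hrk hdnn htri hTY h261 hv hcK ((hasMajorantHom_iff (g := toB6 g R H) _ _ _).mp hW4) hEY
  have k5 := hasKernelBound_comp_decay (R := R) (H := H) blkW d δ₀ α β ρk ρw Λ
    (κ * κ * BX * BL * 1 * Λ ^ 4 * B6.c1 d δ₀ β ^ 2) (BR * α₁) (fun a => P a * ((g.len a ^ 4)⁻¹ * 1)) wY hw₁ hwY hΛ0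
    (by positivity) hBRα hρk hrk hdnn htri hTY h261 hv hcK ((hasMajorantHom_iff (g := toB6 g R H) _ _ _).mp hW5) hRY
  -- sum of the five words = `X·P′(A)·Y` (§2)
  have hsum := hasKernelBound_add (g := toB6 g R H) blkW (hasKernelBound_add (g := toB6 g R H) blkW
    (hasKernelBound_add (g := toB6 g R H) blkW (hasKernelBound_add (g := toB6 g R H) blkW k1 k2) k3) k4) k5
  rw [← pPrime_five_words hinj G E X Y Qc Qc' Fc Qcs Qcs' Fcs Linv Tinv h357 h357s] at hsum
  refine hasKernelBound_mono (g := toB6 g R H) blkW hv hsum fun a b => le_of_eq ?_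
  ring

end Assembly

/-! ## §4  Theorem 3.4, `R(U)`-clause: (3.68) for `P′(A)` in the printed kernel form, printed quantifiers -/

section Final

variable {𝔸 : Type*} [NormedRing 𝔸] [NormedAlgebra ℂ 𝔸] [CompleteSpace 𝔸] {ι : Type} [Fintype ι]
variable (b : Module.Basis ι ℝ 𝔸) {S : Type} {κ : Type} [Fintype κ]
variable (T : κ → Equiv.Perm S) (U : κ → S → 𝔸ˣ)
variable {g : B9.Geometry} [Fintype g.Site] {Rr : ℝ} {H : Prop}

set_option maxHeartbeats 1600000 in
/-- **THEOREM 3.4, `R(U)`-CLAUSE: (3.68) FOR `P′(A)` IN THE PRINTED KERNEL FORM, PRINTED QUANTIFIERS** — p. 403 «Moreover we have P(U′U) = P(U) + P′(A),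
|P′(A;x,x′)|, |(DP′(A))_μ(x,x′)|, |(P′(A)D*)_ν(x,x′)|, |(DP′(A)D*)_{μν}(x,x′)| ≦ O(1)α₁[1, (Lʲη)⁻¹, (Lʲη)⁻¹, (Lʲη)⁻²](L^{j′}η)^{−d}e^{−(1/2)δ₀d(y,y′)} for
x ∈ Δ(y), y ∈ Λ_j, x′ ∈ Δ(y′), y′ ∈ Λ_{j′}. (3.68)»: given Theorem 3.1 for `G′(U)` ((3.26) two-sided inverse of the letter `Δ′_a(U)`; (3.42)₁₋₃ as
block majorants and (3.42)₁₋₄ as kernel bounds at the rate `δ₀`) and Theorem 3.2 for `U` ((3.21) `hLinv`, (3.48) kernel bound `B₁`), [4] Lemma 2.1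
and the p. 398 scale transfer for every exponent, the (3.19) letters with a section `rep` of the block map, the `A`-free (3.60) data: `∃ a₁ > 0 ∃ K ≧ 0
∀ α₁ ∈ [0, a₁] ∀ A` in (3.37) (blockwise) `∀ kF sF ∀` (3.57)/(3.59) letters `Q′(U′U) = Q′ + F′₂`, `Q′*(U′U) = Q′* + F′₂*` (block-local, size `c_Fα₁`):
THERE EXISTS `C⁻¹(U′U)` (two-sided inverse of `Q′(U′U)G′²(U′U)Q′*(U′U)`) such that `P(U′U) = P(U) + P′(A)` and `P′(A) = pPrime G′ G′(U′U) Q′* Q′*(U′U)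
C⁻¹ C⁻¹(U′U) Q′ Q′(U′U)` has the kernel bounds `|P′(A)(x,x′)| ≦ Kα₁e^{−(δ₀/4)d(y,y′)}v(y′)⁻¹`, `|(∇_kP′(A))(x,x′)|, |(P′(A)∇*_l)(x,x′)| ≦
Kα₁(Lʲη)⁻¹e^{−(δ₀/4)d}v(y′)⁻¹`, `|(∇_kP′(A)∇*_l)(x,x′)| ≦ Kα₁(Lʲη)⁻²e^{−(δ₀/4)d}v(y′)⁻¹` — ONE `K`, independent of `α₁` and `A`.
[cite: Balaban1985BackgroundPropagators, Thm 3.4 p.400 + (3.68) p.403 + (3.49) p.399 + (3.25) p.394 + Thm 3.1 (3.42) p.397 + Thm 3.2 (3.48) p.398 + p.398 remark + (3.19)/(3.21) pp.393–394 + (3.57) p.401 + (3.59)–(3.67) pp.402–403 + (3.37) p.396; Balaban1984PropagatorsII, Lemma 2.1 p.234 + (2.51)–(2.55) p.232 + (2.66) p.234 + (2.68) p.235] -/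

theorem thm34_pPrime_kernel_final [Fintype S] [DecidableEq S] [DecidableEq ι] [DecidableEq g.Site] [Nonempty g.Site] (blk : S → g.Site) (d : ℕ)
    (δ₀ κQ BG B₁ cF Cq a₀ d₀ M₂ : ℝ)
    (kQ : g.Site → S → 𝔸 →L[ℝ] 𝔸) (sQ : S → 𝔸 →L[ℝ] 𝔸) (cfun w : g.Site → ℝ)
    (hκQ : 0 < κQ) (hBG : 0 < BG) (hB₁ : 0 < B₁) (hcF : 0 < cF) (hCq : 0 ≤ Cq) (ha₀ : 0 ≤ a₀) (hM₂ : 0 ≤ M₂) (hδ₀ : 0 < δ₀)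
    -- the multiscale geometry 𝔅 and its axioms
    (hdnn : ∀ a a' : g.Site, 0 ≤ g.dist a a') (htri : Triangle254 (toB6 g Rr H)) (hrefl : ∀ y : g.Site, g.dist y y = 0)
    (hsym : ∀ y y' : g.Site, g.dist y y' = g.dist y' y) (hlen : ∀ y : g.Site, 0 < g.len y) (hlenη : ∀ y : g.Site, g.eta ≤ g.len y)
    (hη : 0 < g.eta)
    -- [4] Lemma 2.1 (2.61) at the rate `δ₀`, «for every 0 < α < 1», and the p. 398 scale transfer for every exponent
    (h261 : ∀ α : ℝ, 0 < α → α < 1 → Ineq261 d (toB6 g Rr H) δ₀ α)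
    (hST : ∀ α : ℝ, 0 < α → ∃ Λ : ℝ, 1 ≤ Λ ∧ ScaleTransfer g δ₀ α Λ (fun a => g.len a) ∧ ScaleTransfer g δ₀ α Λ (fun a => g.len a ^ 2) ∧
      ScaleTransfer g δ₀ α Λ (fun a => (g.len a)⁻¹) ∧ ScaleTransfer g δ₀ α Λ (fun a => (g.len a ^ 2)⁻¹) ∧
      ScaleTransfer g δ₀ α Λ (fun a => (g.len a ^ 4)⁻¹) ∧ ScaleTransfer g δ₀ α Λ (fun y => g.len y ^ (-(4 : ℝ))))
    (hrepr : ∀ (v : 𝔸) (i : ι), |b.repr v i| ≤ M₂ * ‖v‖)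
    (hU1 : ∀ m z, ‖((U m z : 𝔸ˣ) : 𝔸)‖ ≤ 1 ∧ ‖(((U m z)⁻¹ : 𝔸ˣ) : 𝔸)‖ ≤ 1)
    (hd₀B : ∀ μ x, g.dist (blk x) (blk ((T μ).symm x)) ≤ d₀) (hd₀F : ∀ μ x, g.dist (blk x) (blk (T μ x)) ≤ d₀)
    (hd₀0 : ∀ y : g.Site, g.dist y y ≤ d₀)
    -- the `A`-independent data of the concrete `V′(A)` of (3.60)
    (hw : ∀ y, 0 ≤ w y) (hcard : ∀ y, ((B9Eq360Vprime.block blk y).card : ℝ) * w y ≤ 1)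
    (hkQ : ∀ y x, blk x = y → ‖kQ y x‖ ≤ w y) (hsQ : ∀ x, ‖sQ x‖ ≤ 1) (hcfun : ∀ y, |cfun y| ≤ a₀ * (g.len y ^ 2)⁻¹)
    -- THEOREM 3.1 for `G′(U)`: (3.42)₁,₂,₃ at the rate `δ₀`
    {Gp : Module.End ℝ (S × ι → ℝ)}
    (h342_1 : HasMajorant (g := toB6 g Rr H) (fun p : S × ι => blk p.1) Gp
      (fun a a' => BG * g.len a ^ 2 * Real.exp (-(δ₀ * g.dist a a'))))
    (h342_2 : ∀ k : κ ⊕ κ, HasMajorant (g := toB6 g Rr H) (fun p : S × ι => blk p.1)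
      (conj b (diffLetter T U ((g.eta : ℂ)⁻¹) k) * Gp) (fun a a' => BG * g.len a * Real.exp (-(δ₀ * g.dist a a'))))
    (h342_3 : ∀ k : κ ⊕ κ, HasMajorant (g := toB6 g Rr H) (fun p : S × ι => blk p.1)
      (Gp * conj b (diffLetter T U ((g.eta : ℂ)⁻¹) k)) (fun a a' => BG * g.len a * Real.exp (-(δ₀ * g.dist a a'))))
    -- the (3.19) letters `Q′(U)`, `Q′*(U)` in their own typing with block-local two-space majorants, a section of the block map (FILE 17)
    (rep : g.Site → S × ι) (hrep : ∀ y : g.Site, blk (rep y).1 = y)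
    {Qc : (S × ι → ℝ) →ₗ[ℝ] (g.Site → ℝ)} {Qcs : (g.Site → ℝ) →ₗ[ℝ] (S × ι → ℝ)} {Linv : Module.End ℝ (g.Site → ℝ)}
    (hQc : HasMajorantHom (g := toB6 g Rr H) (fun p : S × ι => blk p.1) (fun y : g.Site => y) Qc
      (fun a a' : g.Site => κQ * (if a = a' then (1 : ℝ) else 0)))
    (hQcs : HasMajorantHom (g := toB6 g Rr H) (fun y : g.Site => y) (fun p : S × ι => blk p.1) Qcs
      (fun a a' : g.Site => κQ * (if a = a' then (1 : ℝ) else 0)))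
    -- THEOREM 3.2 for `U`: (3.21) `C⁻¹ = (Q′G′²Q′*)⁻¹` exists (`hLinv`) with the KERNEL bound (3.48) at the rate `δ₀`
    (hLinv : (Qc ∘ₗ (Gp * Gp) ∘ₗ Qcs) * Linv = 1)
    (h348 : ∀ y y' : g.Site, |B9Thm34Inv.ker (B9Thm34Inv.vol g d) Linv y y'| ≤
      B₁ * g.len y ^ (-(4 : ℝ)) * g.len y' ^ (-(d : ℝ)) * Real.exp (-(δ₀ * g.dist y y')))
    -- THEOREM 3.1 for `G′(U)`: the letter `Δ′_a(U)` with `G′(U)` its two-sided inverse ((3.26); FILE 26)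
    {Δp : Module.End ℝ (S × ι → ℝ)} (hΔpGp : Δp * Gp = 1) (hGpΔp : Gp * Δp = 1)
    -- the kernel pairing of p. 393 (`c = η^d`, block volume weight `v(y′) = (L^{j′}η)^d`) and THEOREM 3.1's (3.42)₁₋₄ FOR `G′(U)` IN THE PRINTED KERNEL FORM
    {v : g.Site → ℝ} (hv : ∀ y, 0 < v y) {cK : ℝ} (hcK : 0 < cK)
    (hGpk : HasKernelBound (g := toB6 g Rr H) (fun p : S × ι => blk p.1) v cK Gp
      (fun a a' => BG * g.len a ^ 2 * Real.exp (-(δ₀ * g.dist a a'))))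
    (hDGpk : ∀ k : κ ⊕ κ, HasKernelBound (g := toB6 g Rr H) (fun p : S × ι => blk p.1) v cK
      (conj b (diffLetter T U ((g.eta : ℂ)⁻¹) k) * Gp) (fun a a' => BG * g.len a * Real.exp (-(δ₀ * g.dist a a'))))
    (hGpDk : ∀ l : κ ⊕ κ, HasKernelBound (g := toB6 g Rr H) (fun p : S × ι => blk p.1) v cK
      (Gp * conj b (diffLetter T U ((g.eta : ℂ)⁻¹) l)) (fun a a' => BG * g.len a * Real.exp (-(δ₀ * g.dist a a'))))
    (hDGpDk : ∀ k l : κ ⊕ κ, HasKernelBound (g := toB6 g Rr H) (fun p : S × ι => blk p.1) v cK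
      (conj b (diffLetter T U ((g.eta : ℂ)⁻¹) k) * Gp * conj b (diffLetter T U ((g.eta : ℂ)⁻¹) l)) (fun a a' => BG * Real.exp (-(δ₀ * g.dist a a')))) :
    ∃ a₁ : ℝ, 0 < a₁ ∧ ∃ K : ℝ, 0 ≤ K ∧
    ∀ (α₁ : ℝ), 0 ≤ α₁ → α₁ ≤ a₁ →
    -- the exponent field `A` in the domain (3.37), read blockwise, and the `A`-dependent (3.59) data `kF`, `sF`
    ∀ (A : κ → S → 𝔸) (kF : g.Site → S → 𝔸 →L[ℝ] 𝔸) (sF : S → 𝔸 →L[ℝ] 𝔸),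
      (∀ y x, blk x = y → ‖kF y x‖ ≤ Cq * α₁ * w y) → (∀ x, ‖sF x‖ ≤ Cq * α₁) →
      (∀ ν k x, ‖((g.eta : ℂ)⁻¹) • covDstar T U ν (A k) x‖ ≤ α₁ * (g.len (blk x) ^ 2)⁻¹) →
      (∀ μ ν x, ‖((g.eta : ℂ)⁻¹) • covD T U μ (A ν) x‖ ≤ α₁ * (g.len (blk x) ^ 2)⁻¹) →
      (∀ μ x, ‖((g.eta : ℂ)⁻¹) • covDstar T U μ (tauB T U μ (A μ)) x‖ ≤ α₁ * (g.len (blk x) ^ 2)⁻¹) →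
      (∀ k x, ‖A k x‖ ≤ α₁ * (g.len (blk x))⁻¹) → (∀ ν k x, ‖tauB T U ν (A k) x‖ ≤ α₁ * (g.len (blk x))⁻¹) →
    -- the (3.57)/(3.59) letters `F′₂(A)`, `F′₂*(A)` (block-local, size `c_F α₁`)
    ∀ {Qc' Fc : (S × ι → ℝ) →ₗ[ℝ] (g.Site → ℝ)} {Qcs' Fcs : (g.Site → ℝ) →ₗ[ℝ] (S × ι → ℝ)},
      Qc' = Qc + Fc → Qcs' = Qcs + Fcs →
      HasMajorantHom (g := toB6 g Rr H) (fun p : S × ι => blk p.1) (fun y : g.Site => y) Fc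
        (fun a a' : g.Site => cF * α₁ * (if a = a' then (1 : ℝ) else 0)) →
      HasMajorantHom (g := toB6 g Rr H) (fun y : g.Site => y) (fun p : S × ι => blk p.1) Fcs
        (fun a a' : g.Site => cF * α₁ * (if a = a' then (1 : ℝ) else 0)) →
    ∃ Tinv : Module.End ℝ (g.Site → ℝ),
      Tinv * (Qc' ∘ₗ ((gPrimeExtEnd Gp (conj b (vPrimeConc T U g.eta A blk kQ kF sQ sF cfun) * Gp)) * (gPrimeExtEnd Gp (conj b (vPrimeConc T U g.eta A blk kQ kF sQ sF cfun) * Gp))) ∘ₗ Qcs') = 1 ∧ (Qc' ∘ₗ ((gPrimeExtEnd Gp (conj b (vPrimeConc T U g.eta A blk kQ kF sQ sF cfun) * Gp)) * (gPrimeExtEnd Gp (conj b (vPrimeConc T U g.eta A blk kQ kF sQ sF cfun) * Gp))) ∘ₗ Qcs') * Tinv = 1 ∧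
      -- (3.68), first line: `P(U′U) = P(U) + P′(A)` (letters read on the sites through the section `rep`)
      pOp (gPrimeExtEnd Gp (conj b (vPrimeConc T U g.eta A blk kQ kF sQ sF cfun) * Gp)) (Qcs' ∘ₗ secRes rep) (secConj rep Tinv) (secExt rep ∘ₗ Qc') =
        pOp Gp (Qcs ∘ₗ secRes rep) (secConj rep Linv) (secExt rep ∘ₗ Qc) + pPrime Gp (gPrimeExtEnd Gp (conj b (vPrimeConc T U g.eta A blk kQ kF sQ sF cfun) * Gp)) (Qcs ∘ₗ secRes rep) (Qcs' ∘ₗ secRes rep) (secConj rep Linv) (secConj rep Tinv) (secExt rep ∘ₗ Qc) (secExt rep ∘ₗ Qc') ∧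
      -- (3.68): the four entries of `P′(A)` in the printed kernel form, with the factor `α₁`
      HasKernelBound (g := toB6 g Rr H) (fun p : S × ι => blk p.1) v cK (pPrime Gp (gPrimeExtEnd Gp (conj b (vPrimeConc T U g.eta A blk kQ kF sQ sF cfun) * Gp)) (Qcs ∘ₗ secRes rep) (Qcs' ∘ₗ secRes rep) (secConj rep Linv) (secConj rep Tinv) (secExt rep ∘ₗ Qc) (secExt rep ∘ₗ Qc'))
        (fun a a' => K * α₁ * Real.exp (-(1 / 4 * δ₀ * g.dist a a'))) ∧
      (∀ k : κ ⊕ κ, HasKernelBound (g := toB6 g Rr H) (fun p : S × ι => blk p.1) v cK (conj b (diffLetter T U ((g.eta : ℂ)⁻¹) k) * pPrime Gp (gPrimeExtEnd Gp (conj b (vPrimeConc T U g.eta A blk kQ kF sQ sF cfun) * Gp)) (Qcs ∘ₗ secRes rep) (Qcs' ∘ₗ secRes rep) (secConj rep Linv) (secConj rep Tinv) (secExt rep ∘ₗ Qc) (secExt rep ∘ₗ Qc'))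
        (fun a a' => K * α₁ * (g.len a)⁻¹ * Real.exp (-(1 / 4 * δ₀ * g.dist a a')))) ∧
      (∀ l : κ ⊕ κ, HasKernelBound (g := toB6 g Rr H) (fun p : S × ι => blk p.1) v cK (pPrime Gp (gPrimeExtEnd Gp (conj b (vPrimeConc T U g.eta A blk kQ kF sQ sF cfun) * Gp)) (Qcs ∘ₗ secRes rep) (Qcs' ∘ₗ secRes rep) (secConj rep Linv) (secConj rep Tinv) (secExt rep ∘ₗ Qc) (secExt rep ∘ₗ Qc') * conj b (diffLetter T U ((g.eta : ℂ)⁻¹) l))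
        (fun a a' => K * α₁ * (g.len a)⁻¹ * Real.exp (-(1 / 4 * δ₀ * g.dist a a')))) ∧
      (∀ k l : κ ⊕ κ, HasKernelBound (g := toB6 g Rr H) (fun p : S × ι => blk p.1) v cK (conj b (diffLetter T U ((g.eta : ℂ)⁻¹) k) * pPrime Gp (gPrimeExtEnd Gp (conj b (vPrimeConc T U g.eta A blk kQ kF sQ sF cfun) * Gp)) (Qcs ∘ₗ secRes rep) (Qcs' ∘ₗ secRes rep) (secConj rep Linv) (secConj rep Tinv) (secExt rep ∘ₗ Qc) (secExt rep ∘ₗ Qc') * conj b (diffLetter T U ((g.eta : ℂ)⁻¹) l))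
        (fun a a' => K * α₁ * (g.len a ^ 2)⁻¹ * Real.exp (-(1 / 4 * δ₀ * g.dist a a')))) := by
  classical
  obtain ⟨y₀⟩ := ‹Nonempty g.Site›
  -- FILE 26 (`G′(U′U)` left entries; `C⁻¹(U′U)` with (3.48)), FILE 29 (`G′(U′U)·Y` in kernel form), FILE 32 (`(G′(U′U) − G′(U))·Y` in kernel form)
  obtain ⟨a₁, ha₁, B, hB, hGp⟩ := thm34_Gp_final (Rr := Rr) (H := H) b T U blk d δ₀ BG Cq a₀ d₀ M₂ kQ sQ cfun w hBG hCq ha₀ hM₂ hδ₀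
    hdnn htri hrefl hsym hlen hlenη hη h261 hST hrepr hU1 hd₀B hd₀F hd₀0 hw hcard hkQ hsQ hcfun hΔpGp hGpΔp h342_1 h342_2 h342_3
  obtain ⟨a₂, ha₂, B', hB', hGpK⟩ := thm34_Gp_kernel_final (Rr := Rr) (H := H) b T U blk d δ₀ BG Cq a₀ d₀ M₂ kQ sQ cfun w hBG hCq ha₀ hM₂
    hδ₀ hdnn htri hrefl hsym hlen hlenη hη h261 hST hrepr hU1 hd₀B hd₀F hd₀0 hw hcard hkQ hsQ hcfun hΔpGp hGpΔp h342_1 h342_2 h342_3 hv hcK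
    hGpk hDGpk hGpDk hDGpDk
  obtain ⟨a₃, ha₃, hCi⟩ := thm34_Cinv_final (Rr := Rr) (H := H) b T U blk d δ₀ κQ BG B₁ cF Cq a₀ d₀ M₂ kQ sQ cfun w hκQ hBG hB₁ hcF hCq ha₀
    hM₂ hδ₀ hdnn htri hrefl hsym hlen hlenη hη h261 hST hrepr hU1 hd₀B hd₀F hd₀0 hw hcard hkQ hsQ hcfun h342_1 h342_2 hQc hQcs hLinv h348
  obtain ⟨a₄, ha₄, B₄, hB₄, hRem⟩ := remainder365_kernel_final (Rr := Rr) (H := H) b T U blk d δ₀ BG Cq a₀ d₀ M₂ kQ sQ cfun w hBG hCq ha₀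
    hM₂ hδ₀ hdnn htri hrefl hsym hlen hlenη hη h261 hST hrepr hU1 hd₀B hd₀F hd₀0 hw hcard hkQ hsQ hcfun hΔpGp hGpΔp h342_1 h342_2 h342_3
    hv hcK hGpk hDGpk hGpDk hDGpDk
  -- the p. 398 scale transfers and [4] Lemma 2.1 at exponent `1/100` (and at the rate `49δ₀/50` for (3.66))
  obtain ⟨Λ, hΛ1, hT1, hT2, -, -, hT4, -⟩ := hST (1 / 100) (by norm_num)
  have hΛ0 : 0 ≤ Λ := zero_le_one.trans hΛ1
  have h261β : Ineq261 d (toB6 g Rr H) δ₀ (1 / 100) := h261 _ (by norm_num) (by norm_num)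
  have h261c : Ineq261 d (toB6 g Rr H) (49 / 50 * δ₀) (1 / 100) :=
    ineq261_rescale (h261 (1 / 100 * (49 / 50)) (by norm_num) (by norm_num))
  have hc1 : 0 ≤ B6.c1 d δ₀ (1 / 100) := B6RandomWalk.c1_nonneg d δ₀ (1 / 100)
  have hcc' : 0 < B6.c1 d (49 / 50 * δ₀) (1 / 100) := c1_pos_of_ineq261 h261c y₀ (hrefl y₀)
  have hcT : 0 ≤ B6.c1 d (2 / 5 * δ₀) (1 / 10) := B6RandomWalk.c1_nonneg d (2 / 5 * δ₀) (1 / 10)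
  -- «for α₁ sufficiently small» / «of course with different constants» (pp. 402–403): one threshold and two bounds by continuity at `α₁ = 0`
  obtain ⟨ε₁, hε₁, hF1⟩ := exists_threshold_of_continuousAt
    (f := fun α₁ : ℝ => theta363 (Fintype.card κ) 1 α₁ a₀ Cq M₂ (∑ i, ‖b i‖) (Real.exp (δ₀ * d₀)) BG Λ (B6.c1 d δ₀ (1 / 100)) * B6.c1 d (49 / 50 * δ₀) (1 / 100))
    (by unfold theta363 kappa385 cVConc cBConc; fun_prop) (by simp [theta363])
  obtain ⟨K₁, ε₂, hK₁, hε₂, hK₁b⟩ := exists_bound_of_continuousAt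
    (f := fun α₁ : ℝ => kappa385 BG (cVConc (Fintype.card κ) 1 α₁ a₀ Cq M₂ (∑ i, ‖b i‖) (Real.exp (δ₀ * d₀))) 0 0 Λ (B6.c1 d δ₀ (1 / 100)))
    (by unfold kappa385 cVConc cBConc; fun_prop)
  obtain ⟨K₆, ε₃, hK₆, hε₃, hK₆b⟩ := exists_bound_of_continuousAt
    (f := fun α₁ : ℝ => kappa366 κQ cF (kappa385 1 (cVConc (Fintype.card κ) 1 α₁ a₀ Cq M₂ (∑ i, ‖b i‖) (Real.exp (δ₀ * d₀))) 0 0 Λ (B6.c1 d δ₀ (1 / 100))) BG (BG * B6.c1 d (49 / 50 * δ₀) (1 / 100) * (1 - theta363 (Fintype.card κ) 1 α₁ a₀ Cq M₂ (∑ i, ‖b i‖) (Real.exp (δ₀ * d₀)) BG Λ (B6.c1 d δ₀ (1 / 100)) * B6.c1 d (49 / 50 * δ₀) (1 / 100))⁻¹) Λ (B6.c1 d δ₀ (1 / 100)) α₁)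
    (by
      unfold theta363 kappa366 kappa385 cVConc cBConc
      fun_prop (disch := simp))
  -- the `α₁`-free constants of the five words: `B_Xd = B K₁ c₁`, `B_T = 2B₁c₁(2δ₀/5,1/10)`, `B_TL`, and the final `K`
  have hBXd0 : 0 ≤ B * K₁ * B6.c1 d δ₀ (1 / 100) := mul_nonneg (mul_nonneg hB hK₁) hc1
  have hBT0 : 0 ≤ 2 * B₁ * B6.c1 d (2 / 5 * δ₀) (1 / 10) := mul_nonneg (mul_nonneg zero_le_two hB₁.le) hcT
  have hBTL0 : 0 ≤ 2 * B₁ * B6.c1 d (2 / 5 * δ₀) (1 / 10) * K₆ * B₁ * Λ * B6.c1 d δ₀ (1 / 100) * Λ * B6.c1 d δ₀ (1 / 100) := by positivity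
  have hκ' : 0 ≤ κQ + cF := add_nonneg hκQ.le hcF.le
  have hK : 0 ≤ (((κQ + cF) * (κQ + cF) * (B * K₁ * B6.c1 d δ₀ (1 / 100)) * (2 * B₁ * B6.c1 d (2 / 5 * δ₀) (1 / 10)) + cF * (κQ + cF) * BG * (2 * B₁ * B6.c1 d (2 / 5 * δ₀) (1 / 10)) + (κQ + cF) * (κQ + cF) * BG * (2 * B₁ * B6.c1 d (2 / 5 * δ₀) (1 / 10) * K₆ * B₁ * Λ * B6.c1 d δ₀ (1 / 100) * Λ * B6.c1 d δ₀ (1 / 100)) + (κQ + cF) * cF * BG * B₁) * B' + (κQ + cF) * (κQ + cF) * BG * B₁ * B₄) * Λ ^ 4 * B6.c1 d δ₀ (1 / 100) ^ 2 * Λ * B6.c1 d δ₀ (1 / 100) := by positivity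
  refine ⟨min (min (min a₁ a₂) (min a₃ a₄)) (min (min (ε₁ / 2) (ε₂ / 2)) (min (ε₃ / 2) (1 / 4))),
    lt_min (lt_min (lt_min ha₁ ha₂) (lt_min ha₃ ha₄)) (lt_min (lt_min (half_pos hε₁) (half_pos hε₂)) (lt_min (half_pos hε₃) (by norm_num))),
    (((κQ + cF) * (κQ + cF) * (B * K₁ * B6.c1 d δ₀ (1 / 100)) * (2 * B₁ * B6.c1 d (2 / 5 * δ₀) (1 / 10)) + cF * (κQ + cF) * BG * (2 * B₁ * B6.c1 d (2 / 5 * δ₀) (1 / 10)) + (κQ + cF) * (κQ + cF) * BG * (2 * B₁ * B6.c1 d (2 / 5 * δ₀) (1 / 10) * K₆ * B₁ * Λ * B6.c1 d δ₀ (1 / 100) * Λ * B6.c1 d δ₀ (1 / 100)) + (κQ + cF) * cF * BG * B₁) * B' + (κQ + cF) * (κQ + cF) * BG * B₁ * B₄) * Λ ^ 4 * B6.c1 d δ₀ (1 / 100) ^ 2 * Λ * B6.c1 d δ₀ (1 / 100), hK, ?_⟩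
  intro α₁ hα₁0 hα₁1 A kF sF hkF hsF h337B h337F h337Bτ hA hAτB Qc' Fc Qcs' Fcs h357 h357s hFc hFcs
  have hm1 : min (min (min a₁ a₂) (min a₃ a₄)) (min (min (ε₁ / 2) (ε₂ / 2)) (min (ε₃ / 2) (1 / 4))) ≤ min (min a₁ a₂) (min a₃ a₄) := min_le_left _ _
  have hm2 : min (min (min a₁ a₂) (min a₃ a₄)) (min (min (ε₁ / 2) (ε₂ / 2)) (min (ε₃ / 2) (1 / 4))) ≤ min (min (ε₁ / 2) (ε₂ / 2)) (min (ε₃ / 2) (1 / 4)) :=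
    min_le_right _ _
  have hα₁a : α₁ ≤ a₁ := hα₁1.trans (hm1.trans ((min_le_left _ _).trans (min_le_left _ _)))
  have hα₁b : α₁ ≤ a₂ := hα₁1.trans (hm1.trans ((min_le_left _ _).trans (min_le_right _ _)))
  have hα₁c : α₁ ≤ a₃ := hα₁1.trans (hm1.trans ((min_le_right _ _).trans (min_le_left _ _)))
  have hα₁d : α₁ ≤ a₄ := hα₁1.trans (hm1.trans ((min_le_right _ _).trans (min_le_right _ _)))
  have hα₁ε₁ : α₁ ≤ ε₁ / 2 := hα₁1.trans (hm2.trans ((min_le_left _ _).trans (min_le_left _ _)))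
  have hα₁ε₂ : α₁ ≤ ε₂ / 2 := hα₁1.trans (hm2.trans ((min_le_left _ _).trans (min_le_right _ _)))
  have hα₁ε₃ : α₁ ≤ ε₃ / 2 := hα₁1.trans (hm2.trans ((min_le_right _ _).trans (min_le_left _ _)))
  have hα₁q : α₁ ≤ 1 / 4 := hα₁1.trans (hm2.trans ((min_le_right _ _).trans (min_le_right _ _)))
  have hα₁one : α₁ ≤ 1 := by linarith
  have habs : |α₁| = α₁ := abs_of_nonneg hα₁0
  -- the four inputs at this `α₁`, `A`
  obtain ⟨i1, i2, hL, -⟩ := hGp α₁ hα₁0 hα₁a A kF sF hkF hsF h337B h337F h337Bτ hA hAτB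
  obtain ⟨-, -, hKE, -, hKED, -⟩ := hGpK α₁ hα₁0 hα₁b A kF sF hkF hsF h337B h337F h337Bτ hA hAτB
  obtain ⟨Tinv, hTl, hTr, h348T⟩ := hCi α₁ hα₁0 hα₁c A kF sF hkF hsF h337B hA hAτB h357 h357s hFc hFcs
  obtain ⟨-, -, hRk, -, hRkD, -⟩ := hRem α₁ hα₁0 hα₁d A kF sF hkF hsF h337B h337F h337Bτ hA hAτB
  -- the threshold and the two bounds at this `α₁`
  have h1 : theta363 (Fintype.card κ) 1 α₁ a₀ Cq M₂ (∑ i, ‖b i‖) (Real.exp (δ₀ * d₀)) BG Λ (B6.c1 d δ₀ (1 / 100)) * B6.c1 d (49 / 50 * δ₀) (1 / 100) < 1 / 2 :=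
    hF1 α₁ (by rw [habs]; linarith)
  have hhalf : (1 / 2 : ℝ) < 1 := by norm_num
  have hK₁α : kappa385 BG (cVConc (Fintype.card κ) 1 α₁ a₀ Cq M₂ (∑ i, ‖b i‖) (Real.exp (δ₀ * d₀))) 0 0 Λ (B6.c1 d δ₀ (1 / 100)) ≤ K₁ :=
    hK₁b α₁ (by rw [habs]; linarith)
  have hK₆α : kappa366 κQ cF (kappa385 1 (cVConc (Fintype.card κ) 1 α₁ a₀ Cq M₂ (∑ i, ‖b i‖) (Real.exp (δ₀ * d₀))) 0 0 Λ (B6.c1 d δ₀ (1 / 100))) BG (BG * B6.c1 d (49 / 50 * δ₀) (1 / 100) * (1 - theta363 (Fintype.card κ) 1 α₁ a₀ Cq M₂ (∑ i, ‖b i‖) (Real.exp (δ₀ * d₀)) BG Λ (B6.c1 d δ₀ (1 / 100)) * B6.c1 d (49 / 50 * δ₀) (1 / 100))⁻¹) Λ (B6.c1 d δ₀ (1 / 100)) α₁ ≤ K₆ :=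
    hK₆b α₁ (by rw [habs]; linarith)
  refine ⟨Tinv, hTl, hTr, eq368 _ _ _ _ _ _ _ _, ?_⟩
  -- the shapes in which gen 9/10 read (3.37), the transports and the stencil geometry
  have hsmall : ∀ y : g.Site, g.eta * (α₁ * (g.len y)⁻¹) ≤ 1 / 4 := fun y => by
    have hq : g.eta * (g.len y)⁻¹ ≤ 1 := by
      rw [← div_eq_mul_inv]; exact (div_le_one (hlen y)).mpr (hlenη y)
    calc g.eta * (α₁ * (g.len y)⁻¹) = α₁ * (g.eta * (g.len y)⁻¹) := by ring
      _ ≤ α₁ * 1 := mul_le_mul_of_nonneg_left hq hα₁0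
      _ ≤ 1 / 4 := by linarith
  have hA' : ∀ μ x, ‖A μ x‖ ≤ α₁ * (g.len (blk x))⁻¹ ∧ ‖tauB T U μ (A μ) x‖ ≤ α₁ * (g.len (blk x))⁻¹ :=
    fun μ x => ⟨hA μ x, hAτB μ μ x⟩
  have h337s' : ∀ μ x, ‖((g.eta : ℂ)⁻¹) • covDstar T U μ (A μ) x‖ ≤ α₁ * (g.len (blk x) ^ 2)⁻¹ := fun μ x => h337B μ μ x
  have hd₀' : ∀ μ x, g.dist (blk x) (blk (T μ x)) ≤ d₀ ∧ g.dist (blk x) (blk ((T μ).symm x)) ≤ d₀ :=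
    fun μ x => ⟨hd₀F μ x, hd₀B μ x⟩
  have hinj : Function.Injective rep := fun y₁ y₂ h => by rw [← hrep y₁, ← hrep y₂, h]
  -- (3.65) in both resolvent forms, from the inverse identities of FILE 26 and `Δ′_a(U)G′(U) = G′(U)Δ′_a(U) = 1`
  have h365 : gPrimeExtEnd Gp (conj b (vPrimeConc T U g.eta A blk kQ kF sQ sF cfun) * Gp) = Gp + (gPrimeExtEnd Gp (conj b (vPrimeConc T U g.eta A blk kQ kF sQ sF cfun) * Gp)) * (conj b (vPrimeConc T U g.eta A blk kQ kF sQ sF cfun) * Gp) :=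
    eq386_resolvent_of_inverses (Δ := Δp) (Δ' := Δp - conj b (vPrimeConc T U g.eta A blk kQ kF sQ sF cfun)) (V := conj b (vPrimeConc T U g.eta A blk kQ kF sQ sF cfun)) hΔpGp i2 rfl
  have h365r : gPrimeExtEnd Gp (conj b (vPrimeConc T U g.eta A blk kQ kF sQ sF cfun) * Gp) = Gp + (gPrimeExtEnd Gp (conj b (vPrimeConc T U g.eta A blk kQ kF sQ sF cfun) * Gp)) * conj b (vPrimeConc T U g.eta A blk kQ kF sQ sF cfun) * Gp := by
    rw [mul_assoc]; exact h365
  have hR : (gPrimeExtEnd Gp (conj b (vPrimeConc T U g.eta A blk kQ kF sQ sF cfun) * Gp)) * (conj b (vPrimeConc T U g.eta A blk kQ kF sQ sF cfun) * Gp) = gPrimeExtEnd Gp (conj b (vPrimeConc T U g.eta A blk kQ kF sQ sF cfun) * Gp) - Gp := by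
    rw [eq_sub_iff_add_eq]; exact (add_comm _ _).trans h365.symm
  have h365l : gPrimeExtEnd Gp (conj b (vPrimeConc T U g.eta A blk kQ kF sQ sF cfun) * Gp) = Gp + Gp * conj b (vPrimeConc T U g.eta A blk kQ kF sQ sF cfun) * (gPrimeExtEnd Gp (conj b (vPrimeConc T U g.eta A blk kQ kF sQ sF cfun) * Gp)) := by
    have h1 : Gp * ((Δp - conj b (vPrimeConc T U g.eta A blk kQ kF sQ sF cfun)) * (gPrimeExtEnd Gp (conj b (vPrimeConc T U g.eta A blk kQ kF sQ sF cfun) * Gp))) = Gp := by rw [i1, mul_one]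
    rw [sub_mul, mul_sub, ← mul_assoc Gp Δp, hGpΔp, one_mul] at h1
    calc gPrimeExtEnd Gp (conj b (vPrimeConc T U g.eta A blk kQ kF sQ sF cfun) * Gp) = (gPrimeExtEnd Gp (conj b (vPrimeConc T U g.eta A blk kQ kF sQ sF cfun) * Gp) - Gp * (conj b (vPrimeConc T U g.eta A blk kQ kF sQ sF cfun) * (gPrimeExtEnd Gp (conj b (vPrimeConc T U g.eta A blk kQ kF sQ sF cfun) * Gp)))) + Gp * (conj b (vPrimeConc T U g.eta A blk kQ kF sQ sF cfun) * (gPrimeExtEnd Gp (conj b (vPrimeConc T U g.eta A blk kQ kF sQ sF cfun) * Gp))) := (sub_add_cancel _ _).symm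
      _ = Gp + Gp * conj b (vPrimeConc T U g.eta A blk kQ kF sQ sF cfun) * (gPrimeExtEnd Gp (conj b (vPrimeConc T U g.eta A blk kQ kF sQ sF cfun) * Gp)) := by rw [h1, mul_assoc]
  -- the operator identities `X·(G′(U′U) − G′(U)) = (X·G′(U′U))·(V′(A)G′(U))`
  have hop1 : (1 : Module.End ℝ (S × ι → ℝ)) * (gPrimeExtEnd Gp (conj b (vPrimeConc T U g.eta A blk kQ kF sQ sF cfun) * Gp) - Gp) = (gPrimeExtEnd Gp (conj b (vPrimeConc T U g.eta A blk kQ kF sQ sF cfun) * Gp)) * (conj b (vPrimeConc T U g.eta A blk kQ kF sQ sF cfun) * Gp) := by rw [one_mul, hR]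
  have hopk : ∀ k : κ ⊕ κ, conj b (diffLetter T U ((g.eta : ℂ)⁻¹) k) * (gPrimeExtEnd Gp (conj b (vPrimeConc T U g.eta A blk kQ kF sQ sF cfun) * Gp) - Gp) = conj b (diffLetter T U ((g.eta : ℂ)⁻¹) k) * (gPrimeExtEnd Gp (conj b (vPrimeConc T U g.eta A blk kQ kF sQ sF cfun) * Gp)) * (conj b (vPrimeConc T U g.eta A blk kQ kF sQ sF cfun) * Gp) := fun k => by rw [mul_assoc, hR]
  -- (3.65)/(3.66) p. 403: `Q′(U′U)G′²(U′U)Q′*(U′U) = Q′G′²Q′* + C′(A)`; (3.67): `C⁻¹(U′U) − C⁻¹(U) = −C⁻¹(U′U)C′(A)C⁻¹(U)`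
  have hCp : Qc' ∘ₗ ((gPrimeExtEnd Gp (conj b (vPrimeConc T U g.eta A blk kQ kF sQ sF cfun) * Gp)) * (gPrimeExtEnd Gp (conj b (vPrimeConc T U g.eta A blk kQ kF sQ sF cfun) * Gp))) ∘ₗ Qcs' = Qc ∘ₗ (Gp * Gp) ∘ₗ Qcs + cPrimeHom Qc Fc Qcs Fcs Gp (gPrimeExtEnd Gp (conj b (vPrimeConc T U g.eta A blk kQ kF sQ sF cfun) * Gp)) (conj b (vPrimeConc T U g.eta A blk kQ kF sQ sF cfun)) :=
    eq365b_hom Qc Qc' Fc Qcs Qcs' Fcs Gp (gPrimeExtEnd Gp (conj b (vPrimeConc T U g.eta A blk kQ kF sQ sF cfun) * Gp)) (conj b (vPrimeConc T U g.eta A blk kQ kF sQ sF cfun)) h357 h357s h365l h365r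
  have hdiff : Tinv - Linv = -(Tinv * (cPrimeHom Qc Fc Qcs Fcs Gp (gPrimeExtEnd Gp (conj b (vPrimeConc T U g.eta A blk kQ kF sQ sF cfun) * Gp)) (conj b (vPrimeConc T U g.eta A blk kQ kF sQ sF cfun)) * Linv)) := by
    rw [← mul_assoc]
    exact inv_sub_inv_of_367 (Qc ∘ₗ (Gp * Gp) ∘ₗ Qcs) (Qc' ∘ₗ ((gPrimeExtEnd Gp (conj b (vPrimeConc T U g.eta A blk kQ kF sQ sF cfun) * Gp)) * (gPrimeExtEnd Gp (conj b (vPrimeConc T U g.eta A blk kQ kF sQ sF cfun) * Gp))) ∘ₗ Qcs') _ Linv Tinv hCp hTl hLinv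
  -- rate bookkeeping: letters at `17δ₀/50`, prefix words at `3δ₀/10`, kernels at `δ₀/4`, exponents `1/100`
  have hrV : 17 / 50 * δ₀ + (1 / 100 + 1 / 100) * δ₀ ≤ δ₀ := by linarith
  have hρV0 : 0 ≤ 17 / 50 * δ₀ := by linarith
  have hr1 : 49 / 50 * δ₀ + (1 / 100 + 1 / 100) * δ₀ ≤ δ₀ := by linarith
  have hρc0 : 0 ≤ 49 / 50 * δ₀ := by linarith
  have hrC : 9 / 25 * δ₀ + (1 / 100 + 1 / 100) * δ₀ ≤ (1 - 1 / 100) * (49 / 50 * δ₀) := by linarith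
  have hρC0 : 0 ≤ 9 / 25 * δ₀ := by linarith
  have hrTL : 17 / 50 * δ₀ + (1 / 100 + 1 / 100) * δ₀ ≤ 9 / 25 * δ₀ := by linarith
  have hrXd : 17 / 50 * δ₀ + (1 / 100 + 1 / 100) * δ₀ ≤ 9 / 10 * δ₀ := by linarith
  have hrw : 3 / 10 * δ₀ + (2 * (1 / 100) + 1 / 100) * δ₀ ≤ 17 / 50 * δ₀ := by linarith
  have hrk : 1 / 4 * δ₀ + (1 / 100 + 1 / 100) * δ₀ ≤ 3 / 10 * δ₀ := by linarith
  have hρw0 : 0 ≤ 3 / 10 * δ₀ := by linarith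
  have hρk0 : 0 ≤ 1 / 4 * δ₀ := by linarith
  have h1734 : 17 / 50 * δ₀ ≤ δ₀ := by linarith
  have h17925 : 17 / 50 * δ₀ ≤ 9 / 25 * δ₀ := by linarith
  have h1445 : 1 / 4 * δ₀ ≤ 4 / 5 * δ₀ := by linarith
  -- the block-local letters (3.19)/(3.57)/(3.59): `κ = κ′ := κ_Q + c_F` (`α₁ ≦ 1`), `φ := c_F`
  have hQcκ : HasMajorantHom (g := toB6 g Rr H) (fun p : S × ι => blk p.1) (fun y : g.Site => y) Qc
      (fun a a' : g.Site => if a = a' then κQ + cF else 0) :=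
    hasMajorantHom_mono (g := toB6 g Rr H) _ _ hQc fun a a' => by
      split_ifs
      · rw [mul_one]; linarith
      · rw [mul_zero]
  have hQcsκ : HasMajorantHom (g := toB6 g Rr H) (fun y : g.Site => y) (fun p : S × ι => blk p.1) Qcs
      (fun a a' : g.Site => if a = a' then κQ + cF else 0) :=
    hasMajorantHom_mono (g := toB6 g Rr H) _ _ hQcs fun a a' => by
      split_ifs
      · rw [mul_one]; linarith
      · rw [mul_zero]
  have hQc'κ : HasMajorantHom (g := toB6 g Rr H) (fun p : S × ι => blk p.1) (fun y : g.Site => y) Qc'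
      (fun a a' : g.Site => if a = a' then κQ + cF else 0) := by
    rw [h357]
    refine hasMajorantHom_mono (g := toB6 g Rr H) _ _ (hasMajorantHom_add (g := toB6 g Rr H) _ _ hQc hFc) fun a a' => ?_
    split_ifs with hab
    · have hc : cF * α₁ ≤ cF := mul_le_of_le_one_right hcF.le hα₁one
      linarith
    · simp
  have hQcs'κ : HasMajorantHom (g := toB6 g Rr H) (fun y : g.Site => y) (fun p : S × ι => blk p.1) Qcs'
      (fun a a' : g.Site => if a = a' then κQ + cF else 0) := by
    rw [h357s]
    refine hasMajorantHom_mono (g := toB6 g Rr H) _ _ (hasMajorantHom_add (g := toB6 g Rr H) _ _ hQcs hFcs) fun a a' => ?_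
    split_ifs with hab
    · have hc : cF * α₁ ≤ cF := mul_le_of_le_one_right hcF.le hα₁one
      linarith
    · simp
  have hFcφ : HasMajorantHom (g := toB6 g Rr H) (fun p : S × ι => blk p.1) (fun y : g.Site => y) Fc
      (fun a a' : g.Site => if a = a' then cF * α₁ else 0) :=
    hasMajorantHom_mono (g := toB6 g Rr H) _ _ hFc fun a a' => by
      split_ifs
      · rw [mul_one]
      · rw [mul_zero]
  have hFcsφ : HasMajorantHom (g := toB6 g Rr H) (fun y : g.Site => y) (fun p : S × ι => blk p.1) Fcs
      (fun a a' : g.Site => if a = a' then cF * α₁ else 0) :=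
    hasMajorantHom_mono (g := toB6 g Rr H) _ _ hFcs fun a a' => by
      split_ifs
      · rw [mul_one]
      · rw [mul_zero]
  -- `C⁻¹(U′U)` (FILE 26) and `C⁻¹(U)` (Theorem 3.2): the (3.48) kernel bounds read as block majorants on 𝔅, at the letter rate `17δ₀/50`
  have hr4 : ∀ a : g.Site, g.len a ^ (-(4 : ℝ)) = (g.len a ^ 4)⁻¹ := fun a => by
    rw [Real.rpow_neg (hlen a).le, show (4 : ℝ) = ((4 : ℕ) : ℝ) by norm_num, Real.rpow_natCast]
  have hw4 : ∀ a : g.Site, 0 ≤ (g.len a ^ 4)⁻¹ := fun a => inv_nonneg.mpr (by positivity)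
  have hw4p : ∀ a : g.Site, 0 ≤ g.len a ^ 4 := fun a => by positivity
  have hl44 : ∀ a : g.Site, g.len a ^ 4 * (g.len a ^ 4)⁻¹ = 1 := fun a => mul_inv_cancel₀ (pow_ne_zero 4 (hlen a).ne')
  have hTinvM : HasMajorant (g := toB6 g Rr H) (fun y : g.Site => y) Tinv
      (fun a a' => 2 * B₁ * B6.c1 d (2 / 5 * δ₀) (1 / 10) * (g.len a ^ 4)⁻¹ * Real.exp (-(9 / 25 * δ₀ * g.dist a a'))) :=
    hasMajorant_mono (g := toB6 g Rr H) _
      (hasMajorant_id_of_ker (R := Rr) (H := H) d hlen (2 * B₁ * B6.c1 d (2 / 5 * δ₀) (1 / 10)) (fun y => g.len y ^ (-(4 : ℝ)))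
        (fun y y' => Real.exp (-(9 / 25 * δ₀ * g.dist y y'))) h348T) fun a a' => le_of_eq (by simp only [hr4])
  have hTinvW : HasMajorant (g := toB6 g Rr H) (fun y : g.Site => y) Tinv
      (fun a a' => 2 * B₁ * B6.c1 d (2 / 5 * δ₀) (1 / 10) * (g.len a ^ 4)⁻¹ * Real.exp (-(17 / 50 * δ₀ * g.dist a a'))) :=
    hasMajorant_rate_mono (R := Rr) (H := H) _ (2 * B₁ * B6.c1 d (2 / 5 * δ₀) (1 / 10)) (fun a => (g.len a ^ 4)⁻¹) hBT0 hw4 h17925 hdnn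
      hTinvM
  have hLinvM : HasMajorant (g := toB6 g Rr H) (fun y : g.Site => y) Linv
      (fun a a' => B₁ * (g.len a ^ 4)⁻¹ * Real.exp (-(δ₀ * g.dist a a'))) :=
    hasMajorant_mono (g := toB6 g Rr H) _
      (hasMajorant_id_of_ker (R := Rr) (H := H) d hlen B₁ (fun y => g.len y ^ (-(4 : ℝ)))
        (fun y y' => Real.exp (-(δ₀ * g.dist y y'))) h348) fun a a' => le_of_eq (by simp only [hr4])
  have hLinvW : HasMajorant (g := toB6 g Rr H) (fun y : g.Site => y) Linv
      (fun a a' => B₁ * (g.len a ^ 4)⁻¹ * Real.exp (-(17 / 50 * δ₀ * g.dist a a'))) :=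
    hasMajorant_rate_mono (R := Rr) (H := H) _ B₁ (fun a => (g.len a ^ 4)⁻¹) hB₁.le hw4 h1734 hdnn hLinvM
  -- (3.66) for the concrete `V′(A)` (gen 10): `C′(A) ≺ κ₃₆₆α₁(Lʲη)⁴e^{−(9δ₀/25)d}` with `κ₃₆₆(α₁) ≦ K₆`
  have hCpM : HasMajorant (g := toB6 g Rr H) (fun y : g.Site => y) (cPrimeHom Qc Fc Qcs Fcs Gp (gPrimeExtEnd Gp (conj b (vPrimeConc T U g.eta A blk kQ kF sQ sF cfun) * Gp)) (conj b (vPrimeConc T U g.eta A blk kQ kF sQ sF cfun)))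
      (fun a a' => kappa366 κQ cF (kappa385 1 (cVConc (Fintype.card κ) 1 α₁ a₀ Cq M₂ (∑ i, ‖b i‖) (Real.exp (δ₀ * d₀))) 0 0 Λ (B6.c1 d δ₀ (1 / 100))) BG (BG * B6.c1 d (49 / 50 * δ₀) (1 / 100) * (1 - theta363 (Fintype.card κ) 1 α₁ a₀ Cq M₂ (∑ i, ‖b i‖) (Real.exp (δ₀ * d₀)) BG Λ (B6.c1 d δ₀ (1 / 100)) * B6.c1 d (49 / 50 * δ₀) (1 / 100))⁻¹) Λ (B6.c1 d δ₀ (1 / 100)) α₁ * α₁ * g.len a ^ 4 *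
        Real.exp (-(9 / 25 * δ₀ * g.dist a a'))) :=
    hasMajorant_cPrimeHom_vPrime (Rr := Rr) (H := H) b T U blk d hη A kQ kF sQ sF cfun w 1 d₀ M₂ Cq a₀ δ₀ δ₀ (1 / 100) (1 / 100)
      (49 / 50 * δ₀) (9 / 25 * δ₀) Λ BG α₁ (1 / 100) κQ cF hBG.le hα₁0 hΛ0 hρc0 hρC0 (by norm_num) (by norm_num) hδ₀.le hδ₀.le hκQ.le
      hcF.le hr1 (by norm_num) (by norm_num) hrC hdnn hrefl htri hlen h261β h261c hT1 hT2 hM₂ hrepr hsmall hA' h337s' hU1 hd₀' hd₀0 hw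
      hcard hCq ha₀ hkQ hkF hsQ hsF hcfun (h1.trans hhalf) h342_1 h342_2 hQc hQcs hFc hFcs
  have hCpK : HasMajorant (g := toB6 g Rr H) (fun y : g.Site => y) (cPrimeHom Qc Fc Qcs Fcs Gp (gPrimeExtEnd Gp (conj b (vPrimeConc T U g.eta A blk kQ kF sQ sF cfun) * Gp)) (conj b (vPrimeConc T U g.eta A blk kQ kF sQ sF cfun)))
      (fun a a' => K₆ * α₁ * g.len a ^ 4 * Real.exp (-(9 / 25 * δ₀ * g.dist a a'))) :=
    hasMajorant_mono (g := toB6 g Rr H) _ hCpM fun a a' =>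
      mul_le_mul_of_nonneg_right (mul_le_mul_of_nonneg_right (mul_le_mul_of_nonneg_right hK₆α hα₁0) (hw4p a)) (Real.exp_nonneg _)
  -- (3.67): `C⁻¹(U′U) − C⁻¹(U) = −C⁻¹(U′U)·C′(A)·C⁻¹(U) ≺ B_TLα₁(Lʲη)⁻⁴e^{−(17δ₀/50)d}` by [4] (2.52)/(2.55) twice
  have hCpL : HasMajorant (g := toB6 g Rr H) (fun y : g.Site => y) (cPrimeHom Qc Fc Qcs Fcs Gp (gPrimeExtEnd Gp (conj b (vPrimeConc T U g.eta A blk kQ kF sQ sF cfun) * Gp)) (conj b (vPrimeConc T U g.eta A blk kQ kF sQ sF cfun)) * Linv)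
      (fun a a' => (K₆ * α₁ * B₁ * Λ * B6.c1 d δ₀ (1 / 100)) * (g.len a ^ 4 * (g.len a ^ 4)⁻¹) * Real.exp (-(17 / 50 * δ₀ * g.dist a a'))) :=
    hasMajorant_comp_decay (R := Rr) (H := H) (fun y : g.Site => y) d δ₀ (1 / 100) (1 / 100) (17 / 50 * δ₀) (9 / 25 * δ₀) Λ
      (K₆ * α₁) B₁ (fun a => g.len a ^ 4) (fun a => (g.len a ^ 4)⁻¹) hw4p hw4 hΛ0 (mul_nonneg hK₆ hα₁0) hB₁.le hρV0 hrTL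
      hdnn htri hT4 h261β hCpK hLinvW
  have hSTone : ScaleTransfer g δ₀ (1 / 100) Λ (fun _ : g.Site => (1 : ℝ)) := fun y y' => by
    simp only [mul_one]
    have h0 : 0 ≤ 1 / 100 * δ₀ * g.dist y y' := mul_nonneg (mul_nonneg (by norm_num) hδ₀.le) (hdnn y y')
    exact (Real.exp_le_one_iff.mpr (by linarith)).trans hΛ1
  have hw44 : (fun a : g.Site => g.len a ^ 4 * (g.len a ^ 4)⁻¹) = fun _ => (1 : ℝ) := funext hl44
  have hT44 : ScaleTransfer g δ₀ (1 / 100) Λ (fun a : g.Site => g.len a ^ 4 * (g.len a ^ 4)⁻¹) := by rw [hw44]; exact hSTone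
  have hTCL : HasMajorant (g := toB6 g Rr H) (fun y : g.Site => y) (Tinv * (cPrimeHom Qc Fc Qcs Fcs Gp (gPrimeExtEnd Gp (conj b (vPrimeConc T U g.eta A blk kQ kF sQ sF cfun) * Gp)) (conj b (vPrimeConc T U g.eta A blk kQ kF sQ sF cfun)) * Linv))
      (fun a a' => (2 * B₁ * B6.c1 d (2 / 5 * δ₀) (1 / 10) * (K₆ * α₁ * B₁ * Λ * B6.c1 d δ₀ (1 / 100)) * Λ * B6.c1 d δ₀ (1 / 100)) *
        ((g.len a ^ 4)⁻¹ * (g.len a ^ 4 * (g.len a ^ 4)⁻¹)) * Real.exp (-(17 / 50 * δ₀ * g.dist a a'))) :=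
    hasMajorant_comp_decay (R := Rr) (H := H) (fun y : g.Site => y) d δ₀ (1 / 100) (1 / 100) (17 / 50 * δ₀) (9 / 25 * δ₀) Λ
      (2 * B₁ * B6.c1 d (2 / 5 * δ₀) (1 / 10)) (K₆ * α₁ * B₁ * Λ * B6.c1 d δ₀ (1 / 100)) (fun a => (g.len a ^ 4)⁻¹)
      (fun a => g.len a ^ 4 * (g.len a ^ 4)⁻¹) hw4 (fun a => by rw [hl44]; exact zero_le_one) hΛ0 hBT0 (by positivity) hρV0 hrTL
      hdnn htri hT44 h261β hTinvM hCpL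
  have hTL : HasMajorant (g := toB6 g Rr H) (fun y : g.Site => y) (Tinv - Linv)
      (fun a a' => 2 * B₁ * B6.c1 d (2 / 5 * δ₀) (1 / 10) * K₆ * B₁ * Λ * B6.c1 d δ₀ (1 / 100) * Λ * B6.c1 d δ₀ (1 / 100) * α₁ *
        (g.len a ^ 4)⁻¹ * Real.exp (-(17 / 50 * δ₀ * g.dist a a'))) := by
    rw [hdiff]
    refine hasMajorant_mono (g := toB6 g Rr H) _ (hasMajorant_neg (R := Rr) (H := H) _ hTCL) fun a a' => le_of_eq ?_
    rw [hl44]; ring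
  -- (3.63) for `V′(A)G′(U)` (gen 9) with `θ₃₆₃ ≦ K₁α₁`, at the letter rate `17δ₀/50`
  have hVG : HasMajorant (g := toB6 g Rr H) (fun p : S × ι => blk p.1) (conj b (vPrimeConc T U g.eta A blk kQ kF sQ sF cfun) * Gp)
      (fun a a' => theta363 (Fintype.card κ) 1 α₁ a₀ Cq M₂ (∑ i, ‖b i‖) (Real.exp (δ₀ * d₀)) BG Λ (B6.c1 d δ₀ (1 / 100)) *
        Real.exp (-(17 / 50 * δ₀ * g.dist a a'))) :=
    ineq363_op_vPrime b T U blk d hη A kQ kF sQ sF cfun w 1 d₀ M₂ Cq a₀ δ₀ δ₀ (1 / 100) (1 / 100) (17 / 50 * δ₀) Λ BG α₁ hBG.le hα₁0 hΛ0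
      hρV0 (by norm_num) (by norm_num) hδ₀.le hδ₀.le hrV hdnn htri hlen h261β hT1 hT2 hM₂ hrepr hsmall hA' h337s' hU1 hd₀' hd₀0 hw hcard
      hCq ha₀ hkQ hkF hsQ hsF hcfun h342_1 h342_2
  have hθK : theta363 (Fintype.card κ) 1 α₁ a₀ Cq M₂ (∑ i, ‖b i‖) (Real.exp (δ₀ * d₀)) BG Λ (B6.c1 d δ₀ (1 / 100)) ≤ K₁ * α₁ := by
    change kappa385 BG (cVConc (Fintype.card κ) 1 α₁ a₀ Cq M₂ (∑ i, ‖b i‖) (Real.exp (δ₀ * d₀))) 0 0 Λ (B6.c1 d δ₀ (1 / 100)) * α₁ ≤ K₁ * α₁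
    exact mul_le_mul_of_nonneg_right hK₁α hα₁0
  have hVGK : HasMajorant (g := toB6 g Rr H) (fun p : S × ι => blk p.1) (conj b (vPrimeConc T U g.eta A blk kQ kF sQ sF cfun) * Gp)
      (fun a a' => K₁ * α₁ * Real.exp (-(17 / 50 * δ₀ * g.dist a a'))) :=
    hasMajorant_mono (g := toB6 g Rr H) _ hVG fun a a' => mul_le_mul_of_nonneg_right hθK (Real.exp_nonneg _)
  -- the left letters `X·G′(U′U)` (FILE 26) and `X·(G′(U′U) − G′(U)) = (X·G′(U′U))·(V′(A)G′(U))`, `X ∈ {1, ∇_k}`, at the letter rate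
  have hXE1 : HasMajorant (g := toB6 g Rr H) (fun p : S × ι => blk p.1) (gPrimeExtEnd Gp (conj b (vPrimeConc T U g.eta A blk kQ kF sQ sF cfun) * Gp))
      (fun a a' => B * g.len a ^ 2 * Real.exp (-(9 / 10 * δ₀ * g.dist a a'))) := by
    simpa only [one_mul] using hL 1 (fun a => g.len a ^ 2) (fun a => sq_nonneg _) (by simpa only [one_mul] using h342_1)
  have hXEk : ∀ k : κ ⊕ κ, HasMajorant (g := toB6 g Rr H) (fun p : S × ι => blk p.1) (conj b (diffLetter T U ((g.eta : ℂ)⁻¹) k) * (gPrimeExtEnd Gp (conj b (vPrimeConc T U g.eta A blk kQ kF sQ sF cfun) * Gp)))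
      (fun a a' => B * g.len a * Real.exp (-(9 / 10 * δ₀ * g.dist a a'))) := fun k =>
    hL _ (fun a => g.len a) (fun a => (hlen a).le) (h342_2 k)
  have hXd1 : HasMajorant (g := toB6 g Rr H) (fun p : S × ι => blk p.1) ((1 : Module.End ℝ (S × ι → ℝ)) * (gPrimeExtEnd Gp (conj b (vPrimeConc T U g.eta A blk kQ kF sQ sF cfun) * Gp) - Gp))
      (fun a a' => B * K₁ * B6.c1 d δ₀ (1 / 100) * α₁ * g.len a ^ 2 * Real.exp (-(17 / 50 * δ₀ * g.dist a a'))) := by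
    rw [hop1]
    refine hasMajorant_mono (g := toB6 g Rr H) _
      (hasMajorant_comp_decay_right1 (R := Rr) (H := H) (fun p : S × ι => blk p.1) d δ₀ (1 / 100) (1 / 100) (17 / 50 * δ₀) (9 / 10 * δ₀)
        B (K₁ * α₁) (fun a => g.len a ^ 2) (fun a => sq_nonneg _) hB (mul_nonneg hK₁ hα₁0) hρV0 (by positivity) hrXd hdnn htri h261β
        hXE1 hVGK) fun a a' => le_of_eq (by ring)
  have hXdk : ∀ k : κ ⊕ κ, HasMajorant (g := toB6 g Rr H) (fun p : S × ι => blk p.1) (conj b (diffLetter T U ((g.eta : ℂ)⁻¹) k) * (gPrimeExtEnd Gp (conj b (vPrimeConc T U g.eta A blk kQ kF sQ sF cfun) * Gp) - Gp))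
      (fun a a' => B * K₁ * B6.c1 d δ₀ (1 / 100) * α₁ * g.len a * Real.exp (-(17 / 50 * δ₀ * g.dist a a'))) := fun k => by
    rw [hopk k]
    refine hasMajorant_mono (g := toB6 g Rr H) _
      (hasMajorant_comp_decay_right1 (R := Rr) (H := H) (fun p : S × ι => blk p.1) d δ₀ (1 / 100) (1 / 100) (17 / 50 * δ₀) (9 / 10 * δ₀)
        B (K₁ * α₁) (fun a => g.len a) (fun a => (hlen a).le) hB (mul_nonneg hK₁ hα₁0) hρV0 (by positivity) hrXd hdnn htri h261β
        (hXEk k) hVGK) fun a a' => le_of_eq (by ring)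
  have hXG1 : HasMajorant (g := toB6 g Rr H) (fun p : S × ι => blk p.1) ((1 : Module.End ℝ (S × ι → ℝ)) * Gp)
      (fun a a' => BG * g.len a ^ 2 * Real.exp (-(17 / 50 * δ₀ * g.dist a a'))) := by
    rw [one_mul]
    exact hasMajorant_rate_mono (R := Rr) (H := H) _ BG (fun a => g.len a ^ 2) hBG.le (fun a => sq_nonneg _) h1734 hdnn h342_1
  have hXGk : ∀ k : κ ⊕ κ, HasMajorant (g := toB6 g Rr H) (fun p : S × ι => blk p.1) (conj b (diffLetter T U ((g.eta : ℂ)⁻¹) k) * Gp)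
      (fun a a' => BG * g.len a * Real.exp (-(17 / 50 * δ₀ * g.dist a a'))) := fun k =>
    hasMajorant_rate_mono (R := Rr) (H := H) _ BG (fun a => g.len a) hBG.le (fun a => (hlen a).le) h1734 hdnn (h342_2 k)
  -- the right letters in KERNEL form at the rate `δ₀/4`: `G′(U′U)·Y` (FILE 29) and `(G′(U′U) − G′(U))·Y` (FILE 32), `Y ∈ {1, ∇*_l}`
  have hEY1 : HasKernelBound (g := toB6 g Rr H) (fun p : S × ι => blk p.1) v cK (gPrimeExtEnd Gp (conj b (vPrimeConc T U g.eta A blk kQ kF sQ sF cfun) * Gp) * (1 : Module.End ℝ (S × ι → ℝ)))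
      (fun a a' => B' * g.len a ^ 2 * Real.exp (-(1 / 4 * δ₀ * g.dist a a'))) := by
    rw [mul_one]
    exact hasKernelBound_rate_mono (R := Rr) (H := H) _ hv cK B' (fun a => g.len a ^ 2) hB' (fun a => sq_nonneg _) h1445 hdnn hKE
  have hEYl : ∀ l : κ ⊕ κ, HasKernelBound (g := toB6 g Rr H) (fun p : S × ι => blk p.1) v cK (gPrimeExtEnd Gp (conj b (vPrimeConc T U g.eta A blk kQ kF sQ sF cfun) * Gp) * conj b (diffLetter T U ((g.eta : ℂ)⁻¹) l))
      (fun a a' => B' * g.len a * Real.exp (-(1 / 4 * δ₀ * g.dist a a'))) := fun l =>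
    hasKernelBound_rate_mono (R := Rr) (H := H) _ hv cK B' (fun a => g.len a) hB' (fun a => (hlen a).le) h1445 hdnn (hKED l)
  have hRY1 : HasKernelBound (g := toB6 g Rr H) (fun p : S × ι => blk p.1) v cK ((gPrimeExtEnd Gp (conj b (vPrimeConc T U g.eta A blk kQ kF sQ sF cfun) * Gp) - Gp) * (1 : Module.End ℝ (S × ι → ℝ)))
      (fun a a' => B₄ * α₁ * g.len a ^ 2 * Real.exp (-(1 / 4 * δ₀ * g.dist a a'))) := by
    rw [mul_one]
    exact hasKernelBound_rate_mono (R := Rr) (H := H) _ hv cK (B₄ * α₁) (fun a => g.len a ^ 2) (mul_nonneg hB₄ hα₁0)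
      (fun a => sq_nonneg _) h1445 hdnn hRk
  have hRYl : ∀ l : κ ⊕ κ, HasKernelBound (g := toB6 g Rr H) (fun p : S × ι => blk p.1) v cK ((gPrimeExtEnd Gp (conj b (vPrimeConc T U g.eta A blk kQ kF sQ sF cfun) * Gp) - Gp) * conj b (diffLetter T U ((g.eta : ℂ)⁻¹) l))
      (fun a a' => B₄ * α₁ * g.len a * Real.exp (-(1 / 4 * δ₀ * g.dist a a'))) := fun l =>
    hasKernelBound_rate_mono (R := Rr) (H := H) _ hv cK (B₄ * α₁) (fun a => g.len a) (mul_nonneg hB₄ hα₁0) (fun a => (hlen a).le)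
      h1445 hdnn (hRkD l)
  -- weight bookkeeping
  have i11 : ∀ a : g.Site, g.len a ^ 2 * (g.len a ^ 4)⁻¹ * g.len a ^ 2 = 1 := fun a => by
    have hℓ : g.len a ≠ 0 := (hlen a).ne'
    field_simp
  have i21 : ∀ a : g.Site, g.len a * (g.len a ^ 4)⁻¹ * g.len a ^ 2 = (g.len a)⁻¹ := fun a => by
    have hℓ : g.len a ≠ 0 := (hlen a).ne'
    field_simp
  have i12 : ∀ a : g.Site, g.len a ^ 2 * (g.len a ^ 4)⁻¹ * g.len a = (g.len a)⁻¹ := fun a => by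
    have hℓ : g.len a ≠ 0 := (hlen a).ne'
    field_simp
  have i22 : ∀ a : g.Site, g.len a * (g.len a ^ 4)⁻¹ * g.len a = (g.len a ^ 2)⁻¹ := fun a => by
    have hℓ : g.len a ≠ 0 := (hlen a).ne'
    field_simp
  -- the four entries (§3)
  refine ⟨?_, fun k => ?_, fun l => ?_, fun k l => ?_⟩
  · have h := hasKernelBound_pPrime_words (R := Rr) (H := H) (fun p : S × ι => blk p.1) (fun y : g.Site => y) hinj d δ₀ (1 / 100)
      (1 / 100) (17 / 50 * δ₀) (3 / 10 * δ₀) (1 / 4 * δ₀) Λ (κQ + cF) (κQ + cF) cF BG (B * K₁ * B6.c1 d δ₀ (1 / 100))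
      (2 * B₁ * B6.c1 d (2 / 5 * δ₀) (1 / 10)) B₁
      (2 * B₁ * B6.c1 d (2 / 5 * δ₀) (1 / 10) * K₆ * B₁ * Λ * B6.c1 d δ₀ (1 / 100) * Λ * B6.c1 d δ₀ (1 / 100)) B' B₄ α₁
      (fun a => g.len a ^ 2) (fun a => g.len a ^ 2) (fun a => sq_nonneg _) (fun a => sq_nonneg _) hκ' hκ' hcF.le hBG.le hBXd0 hBT0 hB₁.le
      hBTL0 hB' hB₄ hα₁0 hΛ1 hρw0 hρk0 (by norm_num) (by norm_num) hδ₀.le hrw hrk hdnn htri hrefl h261β hT2 hT4 hv hcK h357 h357s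
      hXd1 hXG1 hQcκ hQcsκ hQc'κ hQcs'κ hFcφ hFcsφ hTinvW hLinvW hTL hEY1 hRY1
    simp only [one_mul, mul_one] at h
    refine hasKernelBound_mono (g := toB6 g Rr H) _ hv h fun a a' => le_of_eq ?_
    rw [i11 a]; ring
  · have h := hasKernelBound_pPrime_words (R := Rr) (H := H) (fun p : S × ι => blk p.1) (fun y : g.Site => y) hinj d δ₀ (1 / 100)
      (1 / 100) (17 / 50 * δ₀) (3 / 10 * δ₀) (1 / 4 * δ₀) Λ (κQ + cF) (κQ + cF) cF BG (B * K₁ * B6.c1 d δ₀ (1 / 100))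
      (2 * B₁ * B6.c1 d (2 / 5 * δ₀) (1 / 10)) B₁
      (2 * B₁ * B6.c1 d (2 / 5 * δ₀) (1 / 10) * K₆ * B₁ * Λ * B6.c1 d δ₀ (1 / 100) * Λ * B6.c1 d δ₀ (1 / 100)) B' B₄ α₁
      (fun a => g.len a) (fun a => g.len a ^ 2) (fun a => (hlen a).le) (fun a => sq_nonneg _) hκ' hκ' hcF.le hBG.le hBXd0 hBT0 hB₁.le
      hBTL0 hB' hB₄ hα₁0 hΛ1 hρw0 hρk0 (by norm_num) (by norm_num) hδ₀.le hrw hrk hdnn htri hrefl h261β hT2 hT4 hv hcK h357 h357s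
      (hXdk k) (hXGk k) hQcκ hQcsκ hQc'κ hQcs'κ hFcφ hFcsφ hTinvW hLinvW hTL hEY1 hRY1
    simp only [mul_one] at h
    refine hasKernelBound_mono (g := toB6 g Rr H) _ hv h fun a a' => le_of_eq ?_
    rw [i21 a]
  · have h := hasKernelBound_pPrime_words (R := Rr) (H := H) (fun p : S × ι => blk p.1) (fun y : g.Site => y) hinj d δ₀ (1 / 100)
      (1 / 100) (17 / 50 * δ₀) (3 / 10 * δ₀) (1 / 4 * δ₀) Λ (κQ + cF) (κQ + cF) cF BG (B * K₁ * B6.c1 d δ₀ (1 / 100))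
      (2 * B₁ * B6.c1 d (2 / 5 * δ₀) (1 / 10)) B₁
      (2 * B₁ * B6.c1 d (2 / 5 * δ₀) (1 / 10) * K₆ * B₁ * Λ * B6.c1 d δ₀ (1 / 100) * Λ * B6.c1 d δ₀ (1 / 100)) B' B₄ α₁
      (fun a => g.len a ^ 2) (fun a => g.len a) (fun a => sq_nonneg _) (fun a => (hlen a).le) hκ' hκ' hcF.le hBG.le hBXd0 hBT0 hB₁.le
      hBTL0 hB' hB₄ hα₁0 hΛ1 hρw0 hρk0 (by norm_num) (by norm_num) hδ₀.le hrw hrk hdnn htri hrefl h261β hT1 hT4 hv hcK h357 h357s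
      hXd1 hXG1 hQcκ hQcsκ hQc'κ hQcs'κ hFcφ hFcsφ hTinvW hLinvW hTL (hEYl l) (hRYl l)
    simp only [one_mul] at h
    refine hasKernelBound_mono (g := toB6 g Rr H) _ hv h fun a a' => le_of_eq ?_
    rw [i12 a]
  · have h := hasKernelBound_pPrime_words (R := Rr) (H := H) (fun p : S × ι => blk p.1) (fun y : g.Site => y) hinj d δ₀ (1 / 100)
      (1 / 100) (17 / 50 * δ₀) (3 / 10 * δ₀) (1 / 4 * δ₀) Λ (κQ + cF) (κQ + cF) cF BG (B * K₁ * B6.c1 d δ₀ (1 / 100))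
      (2 * B₁ * B6.c1 d (2 / 5 * δ₀) (1 / 10)) B₁
      (2 * B₁ * B6.c1 d (2 / 5 * δ₀) (1 / 10) * K₆ * B₁ * Λ * B6.c1 d δ₀ (1 / 100) * Λ * B6.c1 d δ₀ (1 / 100)) B' B₄ α₁
      (fun a => g.len a) (fun a => g.len a) (fun a => (hlen a).le) (fun a => (hlen a).le) hκ' hκ' hcF.le hBG.le hBXd0 hBT0 hB₁.le
      hBTL0 hB' hB₄ hα₁0 hΛ1 hρw0 hρk0 (by norm_num) (by norm_num) hδ₀.le hrw hrk hdnn htri hrefl h261β hT1 hT4 hv hcK h357 h357s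
      (hXdk k) (hXGk k) hQcκ hQcsκ hQc'κ hQcs'κ hFcφ hFcsφ hTinvW hLinvW hTL (hEYl l) (hRYl l)
    refine hasKernelBound_mono (g := toB6 g Rr H) _ hv h fun a a' => le_of_eq ?_
    rw [i22 a]


end Final
/-! ## §5  Theorem 3.4, the `R(U)`-clause COMPLETE in the printed kernel form: (3.49) for `P(U′U)` and (3.68) for `P′(A)`, one `C⁻¹(U′U)` -/

section Capstone

variable {𝔸 : Type*} [NormedRing 𝔸] [NormedAlgebra ℂ 𝔸] [CompleteSpace 𝔸] {ι : Type} [Fintype ι]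
variable (b : Module.Basis ι ℝ 𝔸) {S : Type} {κ : Type} [Fintype κ]
variable (T : κ → Equiv.Perm S) (U : κ → S → 𝔸ˣ)
variable {g : B9.Geometry} [Fintype g.Site] {Rr : ℝ} {H : Prop}

set_option maxHeartbeats 1600000 in
/-- **THEOREM 3.4, THE `R(U)`-CLAUSE COMPLETE IN THE PRINTED KERNEL FORM** — p. 403 «the operators R(U), P(U) = I − R(U) extend analytically to the domain
(3.37) and satisfy the same bounds, e.g. the operator P(U′U) satisfies the bounds (3.49). Moreover we have P(U′U) = P(U) + P′(A), [(3.68)]»: under the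
hypotheses of `thm34_pPrime_kernel_final` (= FILE 30's), `∃ a₁ > 0 ∃ K ≧ 0 ∀ α₁ ∈ [0, a₁] ∀ A` in (3.37) (blockwise) `∀ kF sF ∀` (3.57)/(3.59) letters:
THERE EXISTS `C⁻¹(U′U)`, two-sided inverse of `Q′(U′U)G′²(U′U)Q′*(U′U)` on 𝔅, with `P(U′U) = P(U) + P′(A)`, the four (3.49) kernel bounds
`[|P(U′U)(x,x′)|, |(∇_kP(U′U))(x,x′)|, |(P(U′U)∇*_l)(x,x′)|, |(∇_kP(U′U)∇*_l)(x,x′)|] ≦ K[1, (Lʲη)⁻¹, (Lʲη)⁻¹, (Lʲη)⁻²]e^{−(δ₀/5)d(y,y′)}v(y′)⁻¹` (FILE 30)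
AND the four (3.68) kernel bounds `[|P′(A)(x,x′)|, …] ≦ Kα₁[1, (Lʲη)⁻¹, (Lʲη)⁻¹, (Lʲη)⁻²]e^{−(δ₀/5)d(y,y′)}v(y′)⁻¹` (§4) — the two files' `C⁻¹(U′U)`
coincide since a two-sided inverse is unique.
[cite: Balaban1985BackgroundPropagators, Thm 3.4 p.400 + (3.49) p.399 + (3.68) p.403 + (3.25) p.394 + Thm 3.1 (3.42) p.397 + Thm 3.2 (3.48) p.398 + (3.57)–(3.67) pp.401–403 + (3.37) p.396; Balaban1984PropagatorsII, Lemma 2.1 p.234 + (2.51)–(2.55) p.232] -/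

theorem thm34_R_kernel_final [Fintype S] [DecidableEq S] [DecidableEq ι] [DecidableEq g.Site] [Nonempty g.Site] (blk : S → g.Site) (d : ℕ)
    (δ₀ κQ BG B₁ cF Cq a₀ d₀ M₂ : ℝ)
    (kQ : g.Site → S → 𝔸 →L[ℝ] 𝔸) (sQ : S → 𝔸 →L[ℝ] 𝔸) (cfun w : g.Site → ℝ)
    (hκQ : 0 < κQ) (hBG : 0 < BG) (hB₁ : 0 < B₁) (hcF : 0 < cF) (hCq : 0 ≤ Cq) (ha₀ : 0 ≤ a₀) (hM₂ : 0 ≤ M₂) (hδ₀ : 0 < δ₀)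
    -- the multiscale geometry 𝔅 and its axioms
    (hdnn : ∀ a a' : g.Site, 0 ≤ g.dist a a') (htri : Triangle254 (toB6 g Rr H)) (hrefl : ∀ y : g.Site, g.dist y y = 0)
    (hsym : ∀ y y' : g.Site, g.dist y y' = g.dist y' y) (hlen : ∀ y : g.Site, 0 < g.len y) (hlenη : ∀ y : g.Site, g.eta ≤ g.len y)
    (hη : 0 < g.eta)
    -- [4] Lemma 2.1 (2.61) at the rate `δ₀`, «for every 0 < α < 1», and the p. 398 scale transfer for every exponent
    (h261 : ∀ α : ℝ, 0 < α → α < 1 → Ineq261 d (toB6 g Rr H) δ₀ α)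
    (hST : ∀ α : ℝ, 0 < α → ∃ Λ : ℝ, 1 ≤ Λ ∧ ScaleTransfer g δ₀ α Λ (fun a => g.len a) ∧ ScaleTransfer g δ₀ α Λ (fun a => g.len a ^ 2) ∧
      ScaleTransfer g δ₀ α Λ (fun a => (g.len a)⁻¹) ∧ ScaleTransfer g δ₀ α Λ (fun a => (g.len a ^ 2)⁻¹) ∧
      ScaleTransfer g δ₀ α Λ (fun a => (g.len a ^ 4)⁻¹) ∧ ScaleTransfer g δ₀ α Λ (fun y => g.len y ^ (-(4 : ℝ))))
    (hrepr : ∀ (v : 𝔸) (i : ι), |b.repr v i| ≤ M₂ * ‖v‖)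
    (hU1 : ∀ m z, ‖((U m z : 𝔸ˣ) : 𝔸)‖ ≤ 1 ∧ ‖(((U m z)⁻¹ : 𝔸ˣ) : 𝔸)‖ ≤ 1)
    (hd₀B : ∀ μ x, g.dist (blk x) (blk ((T μ).symm x)) ≤ d₀) (hd₀F : ∀ μ x, g.dist (blk x) (blk (T μ x)) ≤ d₀)
    (hd₀0 : ∀ y : g.Site, g.dist y y ≤ d₀)
    -- the `A`-independent data of the concrete `V′(A)` of (3.60)
    (hw : ∀ y, 0 ≤ w y) (hcard : ∀ y, ((B9Eq360Vprime.block blk y).card : ℝ) * w y ≤ 1)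
    (hkQ : ∀ y x, blk x = y → ‖kQ y x‖ ≤ w y) (hsQ : ∀ x, ‖sQ x‖ ≤ 1) (hcfun : ∀ y, |cfun y| ≤ a₀ * (g.len y ^ 2)⁻¹)
    -- THEOREM 3.1 for `G′(U)`: (3.42)₁,₂,₃ at the rate `δ₀`
    {Gp : Module.End ℝ (S × ι → ℝ)}
    (h342_1 : HasMajorant (g := toB6 g Rr H) (fun p : S × ι => blk p.1) Gp
      (fun a a' => BG * g.len a ^ 2 * Real.exp (-(δ₀ * g.dist a a'))))
    (h342_2 : ∀ k : κ ⊕ κ, HasMajorant (g := toB6 g Rr H) (fun p : S × ι => blk p.1)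
      (conj b (diffLetter T U ((g.eta : ℂ)⁻¹) k) * Gp) (fun a a' => BG * g.len a * Real.exp (-(δ₀ * g.dist a a'))))
    (h342_3 : ∀ k : κ ⊕ κ, HasMajorant (g := toB6 g Rr H) (fun p : S × ι => blk p.1)
      (Gp * conj b (diffLetter T U ((g.eta : ℂ)⁻¹) k)) (fun a a' => BG * g.len a * Real.exp (-(δ₀ * g.dist a a'))))
    -- the (3.19) letters `Q′(U)`, `Q′*(U)` in their own typing with block-local two-space majorants, a section of the block map (FILE 17)
    (rep : g.Site → S × ι) (hrep : ∀ y : g.Site, blk (rep y).1 = y)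
    {Qc : (S × ι → ℝ) →ₗ[ℝ] (g.Site → ℝ)} {Qcs : (g.Site → ℝ) →ₗ[ℝ] (S × ι → ℝ)} {Linv : Module.End ℝ (g.Site → ℝ)}
    (hQc : HasMajorantHom (g := toB6 g Rr H) (fun p : S × ι => blk p.1) (fun y : g.Site => y) Qc
      (fun a a' : g.Site => κQ * (if a = a' then (1 : ℝ) else 0)))
    (hQcs : HasMajorantHom (g := toB6 g Rr H) (fun y : g.Site => y) (fun p : S × ι => blk p.1) Qcs
      (fun a a' : g.Site => κQ * (if a = a' then (1 : ℝ) else 0)))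
    -- THEOREM 3.2 for `U`: (3.21) `C⁻¹ = (Q′G′²Q′*)⁻¹` exists (`hLinv`) with the KERNEL bound (3.48) at the rate `δ₀`
    (hLinv : (Qc ∘ₗ (Gp * Gp) ∘ₗ Qcs) * Linv = 1)
    (h348 : ∀ y y' : g.Site, |B9Thm34Inv.ker (B9Thm34Inv.vol g d) Linv y y'| ≤
      B₁ * g.len y ^ (-(4 : ℝ)) * g.len y' ^ (-(d : ℝ)) * Real.exp (-(δ₀ * g.dist y y')))
    -- THEOREM 3.1 for `G′(U)`: the letter `Δ′_a(U)` with `G′(U)` its two-sided inverse ((3.26); FILE 26)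
    {Δp : Module.End ℝ (S × ι → ℝ)} (hΔpGp : Δp * Gp = 1) (hGpΔp : Gp * Δp = 1)
    -- the kernel pairing of p. 393 (`c = η^d`, block volume weight `v(y′) = (L^{j′}η)^d`) and THEOREM 3.1's (3.42)₁₋₄ FOR `G′(U)` IN THE PRINTED KERNEL FORM
    {v : g.Site → ℝ} (hv : ∀ y, 0 < v y) {cK : ℝ} (hcK : 0 < cK)
    (hGpk : HasKernelBound (g := toB6 g Rr H) (fun p : S × ι => blk p.1) v cK Gp
      (fun a a' => BG * g.len a ^ 2 * Real.exp (-(δ₀ * g.dist a a'))))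
    (hDGpk : ∀ k : κ ⊕ κ, HasKernelBound (g := toB6 g Rr H) (fun p : S × ι => blk p.1) v cK
      (conj b (diffLetter T U ((g.eta : ℂ)⁻¹) k) * Gp) (fun a a' => BG * g.len a * Real.exp (-(δ₀ * g.dist a a'))))
    (hGpDk : ∀ l : κ ⊕ κ, HasKernelBound (g := toB6 g Rr H) (fun p : S × ι => blk p.1) v cK
      (Gp * conj b (diffLetter T U ((g.eta : ℂ)⁻¹) l)) (fun a a' => BG * g.len a * Real.exp (-(δ₀ * g.dist a a'))))
    (hDGpDk : ∀ k l : κ ⊕ κ, HasKernelBound (g := toB6 g Rr H) (fun p : S × ι => blk p.1) v cK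
      (conj b (diffLetter T U ((g.eta : ℂ)⁻¹) k) * Gp * conj b (diffLetter T U ((g.eta : ℂ)⁻¹) l)) (fun a a' => BG * Real.exp (-(δ₀ * g.dist a a')))) :
    ∃ a₁ : ℝ, 0 < a₁ ∧ ∃ K : ℝ, 0 ≤ K ∧
    ∀ (α₁ : ℝ), 0 ≤ α₁ → α₁ ≤ a₁ →
    -- the exponent field `A` in the domain (3.37), read blockwise, and the `A`-dependent (3.59) data `kF`, `sF`
    ∀ (A : κ → S → 𝔸) (kF : g.Site → S → 𝔸 →L[ℝ] 𝔸) (sF : S → 𝔸 →L[ℝ] 𝔸),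
      (∀ y x, blk x = y → ‖kF y x‖ ≤ Cq * α₁ * w y) → (∀ x, ‖sF x‖ ≤ Cq * α₁) →
      (∀ ν k x, ‖((g.eta : ℂ)⁻¹) • covDstar T U ν (A k) x‖ ≤ α₁ * (g.len (blk x) ^ 2)⁻¹) →
      (∀ μ ν x, ‖((g.eta : ℂ)⁻¹) • covD T U μ (A ν) x‖ ≤ α₁ * (g.len (blk x) ^ 2)⁻¹) →
      (∀ μ x, ‖((g.eta : ℂ)⁻¹) • covDstar T U μ (tauB T U μ (A μ)) x‖ ≤ α₁ * (g.len (blk x) ^ 2)⁻¹) →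
      (∀ k x, ‖A k x‖ ≤ α₁ * (g.len (blk x))⁻¹) → (∀ ν k x, ‖tauB T U ν (A k) x‖ ≤ α₁ * (g.len (blk x))⁻¹) →
    -- the (3.57)/(3.59) letters `F′₂(A)`, `F′₂*(A)` (block-local, size `c_F α₁`)
    ∀ {Qc' Fc : (S × ι → ℝ) →ₗ[ℝ] (g.Site → ℝ)} {Qcs' Fcs : (g.Site → ℝ) →ₗ[ℝ] (S × ι → ℝ)},
      Qc' = Qc + Fc → Qcs' = Qcs + Fcs →
      HasMajorantHom (g := toB6 g Rr H) (fun p : S × ι => blk p.1) (fun y : g.Site => y) Fc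
        (fun a a' : g.Site => cF * α₁ * (if a = a' then (1 : ℝ) else 0)) →
      HasMajorantHom (g := toB6 g Rr H) (fun y : g.Site => y) (fun p : S × ι => blk p.1) Fcs
        (fun a a' : g.Site => cF * α₁ * (if a = a' then (1 : ℝ) else 0)) →
    ∃ Tinv : Module.End ℝ (g.Site → ℝ),
      Tinv * (Qc' ∘ₗ ((gPrimeExtEnd Gp (conj b (vPrimeConc T U g.eta A blk kQ kF sQ sF cfun) * Gp)) * (gPrimeExtEnd Gp (conj b (vPrimeConc T U g.eta A blk kQ kF sQ sF cfun) * Gp))) ∘ₗ Qcs') = 1 ∧ (Qc' ∘ₗ ((gPrimeExtEnd Gp (conj b (vPrimeConc T U g.eta A blk kQ kF sQ sF cfun) * Gp)) * (gPrimeExtEnd Gp (conj b (vPrimeConc T U g.eta A blk kQ kF sQ sF cfun) * Gp))) ∘ₗ Qcs') * Tinv = 1 ∧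
      -- (3.68), first line: `P(U′U) = P(U) + P′(A)`
      pOp (gPrimeExtEnd Gp (conj b (vPrimeConc T U g.eta A blk kQ kF sQ sF cfun) * Gp)) (Qcs' ∘ₗ secRes rep) (secConj rep Tinv) (secExt rep ∘ₗ Qc') = pOp Gp (Qcs ∘ₗ secRes rep) (secConj rep Linv) (secExt rep ∘ₗ Qc) + pPrime Gp (gPrimeExtEnd Gp (conj b (vPrimeConc T U g.eta A blk kQ kF sQ sF cfun) * Gp)) (Qcs ∘ₗ secRes rep) (Qcs' ∘ₗ secRes rep) (secConj rep Linv) (secConj rep Tinv) (secExt rep ∘ₗ Qc) (secExt rep ∘ₗ Qc') ∧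
      -- (3.49) for `P(U′U)` in the printed kernel form (FILE 30)
      HasKernelBound (g := toB6 g Rr H) (fun p : S × ι => blk p.1) v cK (pOp (gPrimeExtEnd Gp (conj b (vPrimeConc T U g.eta A blk kQ kF sQ sF cfun) * Gp)) (Qcs' ∘ₗ secRes rep) (secConj rep Tinv) (secExt rep ∘ₗ Qc'))
        (fun a a' => K * Real.exp (-(1 / 5 * δ₀ * g.dist a a'))) ∧
      (∀ k : κ ⊕ κ, HasKernelBound (g := toB6 g Rr H) (fun p : S × ι => blk p.1) v cK (conj b (diffLetter T U ((g.eta : ℂ)⁻¹) k) * pOp (gPrimeExtEnd Gp (conj b (vPrimeConc T U g.eta A blk kQ kF sQ sF cfun) * Gp)) (Qcs' ∘ₗ secRes rep) (secConj rep Tinv) (secExt rep ∘ₗ Qc'))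
        (fun a a' => K * (g.len a)⁻¹ * Real.exp (-(1 / 5 * δ₀ * g.dist a a')))) ∧
      (∀ l : κ ⊕ κ, HasKernelBound (g := toB6 g Rr H) (fun p : S × ι => blk p.1) v cK (pOp (gPrimeExtEnd Gp (conj b (vPrimeConc T U g.eta A blk kQ kF sQ sF cfun) * Gp)) (Qcs' ∘ₗ secRes rep) (secConj rep Tinv) (secExt rep ∘ₗ Qc') * conj b (diffLetter T U ((g.eta : ℂ)⁻¹) l))
        (fun a a' => K * (g.len a)⁻¹ * Real.exp (-(1 / 5 * δ₀ * g.dist a a')))) ∧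
      (∀ k l : κ ⊕ κ, HasKernelBound (g := toB6 g Rr H) (fun p : S × ι => blk p.1) v cK (conj b (diffLetter T U ((g.eta : ℂ)⁻¹) k) * pOp (gPrimeExtEnd Gp (conj b (vPrimeConc T U g.eta A blk kQ kF sQ sF cfun) * Gp)) (Qcs' ∘ₗ secRes rep) (secConj rep Tinv) (secExt rep ∘ₗ Qc') * conj b (diffLetter T U ((g.eta : ℂ)⁻¹) l))
        (fun a a' => K * (g.len a ^ 2)⁻¹ * Real.exp (-(1 / 5 * δ₀ * g.dist a a')))) ∧
      -- (3.68) for `P′(A)` in the printed kernel form, with the factor `α₁` (§4)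
      HasKernelBound (g := toB6 g Rr H) (fun p : S × ι => blk p.1) v cK (pPrime Gp (gPrimeExtEnd Gp (conj b (vPrimeConc T U g.eta A blk kQ kF sQ sF cfun) * Gp)) (Qcs ∘ₗ secRes rep) (Qcs' ∘ₗ secRes rep) (secConj rep Linv) (secConj rep Tinv) (secExt rep ∘ₗ Qc) (secExt rep ∘ₗ Qc'))
        (fun a a' => K * α₁ * Real.exp (-(1 / 5 * δ₀ * g.dist a a'))) ∧
      (∀ k : κ ⊕ κ, HasKernelBound (g := toB6 g Rr H) (fun p : S × ι => blk p.1) v cK (conj b (diffLetter T U ((g.eta : ℂ)⁻¹) k) * pPrime Gp (gPrimeExtEnd Gp (conj b (vPrimeConc T U g.eta A blk kQ kF sQ sF cfun) * Gp)) (Qcs ∘ₗ secRes rep) (Qcs' ∘ₗ secRes rep) (secConj rep Linv) (secConj rep Tinv) (secExt rep ∘ₗ Qc) (secExt rep ∘ₗ Qc'))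
        (fun a a' => K * α₁ * (g.len a)⁻¹ * Real.exp (-(1 / 5 * δ₀ * g.dist a a')))) ∧
      (∀ l : κ ⊕ κ, HasKernelBound (g := toB6 g Rr H) (fun p : S × ι => blk p.1) v cK (pPrime Gp (gPrimeExtEnd Gp (conj b (vPrimeConc T U g.eta A blk kQ kF sQ sF cfun) * Gp)) (Qcs ∘ₗ secRes rep) (Qcs' ∘ₗ secRes rep) (secConj rep Linv) (secConj rep Tinv) (secExt rep ∘ₗ Qc) (secExt rep ∘ₗ Qc') * conj b (diffLetter T U ((g.eta : ℂ)⁻¹) l))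
        (fun a a' => K * α₁ * (g.len a)⁻¹ * Real.exp (-(1 / 5 * δ₀ * g.dist a a')))) ∧
      (∀ k l : κ ⊕ κ, HasKernelBound (g := toB6 g Rr H) (fun p : S × ι => blk p.1) v cK (conj b (diffLetter T U ((g.eta : ℂ)⁻¹) k) * pPrime Gp (gPrimeExtEnd Gp (conj b (vPrimeConc T U g.eta A blk kQ kF sQ sF cfun) * Gp)) (Qcs ∘ₗ secRes rep) (Qcs' ∘ₗ secRes rep) (secConj rep Linv) (secConj rep Tinv) (secExt rep ∘ₗ Qc) (secExt rep ∘ₗ Qc') * conj b (diffLetter T U ((g.eta : ℂ)⁻¹) l))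
        (fun a a' => K * α₁ * (g.len a ^ 2)⁻¹ * Real.exp (-(1 / 5 * δ₀ * g.dist a a')))) := by
  obtain ⟨a₁, ha₁, K₁, hK₁, h30⟩ := thm34_P_kernel_final (Rr := Rr) (H := H) b T U blk d δ₀ κQ BG B₁ cF Cq a₀ d₀ M₂ kQ sQ cfun w hκQ hBG hB₁
    hcF hCq ha₀ hM₂ hδ₀ hdnn htri hrefl hsym hlen hlenη hη h261 hST hrepr hU1 hd₀B hd₀F hd₀0 hw hcard hkQ hsQ hcfun h342_1 h342_2 h342_3 rep
    hrep hQc hQcs hLinv h348 hΔpGp hGpΔp hv hcK hGpk hDGpk hGpDk hDGpDk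
  obtain ⟨a₂, ha₂, K₂, hK₂, h33⟩ := thm34_pPrime_kernel_final (Rr := Rr) (H := H) b T U blk d δ₀ κQ BG B₁ cF Cq a₀ d₀ M₂ kQ sQ cfun w hκQ hBG
    hB₁ hcF hCq ha₀ hM₂ hδ₀ hdnn htri hrefl hsym hlen hlenη hη h261 hST hrepr hU1 hd₀B hd₀F hd₀0 hw hcard hkQ hsQ hcfun h342_1 h342_2 h342_3
    rep hrep hQc hQcs hLinv h348 hΔpGp hGpΔp hv hcK hGpk hDGpk hGpDk hDGpDk
  refine ⟨min a₁ a₂, lt_min ha₁ ha₂, K₁ + K₂, add_nonneg hK₁ hK₂, ?_⟩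
  intro α₁ hα₁0 hα₁1 A kF sF hkF hsF h337B h337F h337Bτ hA hAτB Qc' Fc Qcs' Fcs h357 h357s hFc hFcs
  obtain ⟨T₁, hT₁l, hT₁r, hP1, hP2, hP3, hP4⟩ := h30 α₁ hα₁0 (hα₁1.trans (min_le_left _ _)) A kF sF hkF hsF h337B h337F h337Bτ hA hAτB
    h357 h357s hFc hFcs
  obtain ⟨T₂, hT₂l, hT₂r, h368, hQ1, hQ2, hQ3, hQ4⟩ := h33 α₁ hα₁0 (hα₁1.trans (min_le_right _ _)) A kF sF hkF hsF h337B h337F h337Bτ hA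
    hAτB h357 h357s hFc hFcs
  -- a two-sided inverse is unique: FILE 30's `C⁻¹(U′U)` is §4's
  have hTT : T₁ = T₂ :=
    calc T₁ = T₁ * ((Qc' ∘ₗ ((gPrimeExtEnd Gp (conj b (vPrimeConc T U g.eta A blk kQ kF sQ sF cfun) * Gp)) * (gPrimeExtEnd Gp (conj b (vPrimeConc T U g.eta A blk kQ kF sQ sF cfun) * Gp))) ∘ₗ Qcs') * T₂) := by rw [hT₂r, mul_one]
      _ = (T₁ * (Qc' ∘ₗ ((gPrimeExtEnd Gp (conj b (vPrimeConc T U g.eta A blk kQ kF sQ sF cfun) * Gp)) * (gPrimeExtEnd Gp (conj b (vPrimeConc T U g.eta A blk kQ kF sQ sF cfun) * Gp))) ∘ₗ Qcs')) * T₂ := (mul_assoc _ _ _).symm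
      _ = T₂ := by rw [hT₁l, one_mul]
  rw [hTT] at hP1 hP2 hP3 hP4
  -- constant and rate bookkeeping: `K₁, K₂ ≦ K₁ + K₂`, `e^{−(δ₀/4)d} ≦ e^{−(δ₀/5)d}`
  have hw1 : ∀ a : g.Site, 0 ≤ (g.len a)⁻¹ := fun a => inv_nonneg.mpr (hlen a).le
  have hw2 : ∀ a : g.Site, 0 ≤ (g.len a ^ 2)⁻¹ := fun a => inv_nonneg.mpr (sq_nonneg _)
  have hexp : ∀ a a' : g.Site, Real.exp (-(1 / 4 * δ₀ * g.dist a a')) ≤ Real.exp (-(1 / 5 * δ₀ * g.dist a a')) := fun a a' => by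
    have h0 : 0 ≤ δ₀ * g.dist a a' := mul_nonneg hδ₀.le (hdnn a a')
    exact Real.exp_le_exp.mpr (by linarith)
  have hK1 : K₁ ≤ K₁ + K₂ := by linarith
  have hK12 : K₂ * α₁ ≤ (K₁ + K₂) * α₁ := mul_le_mul_of_nonneg_right (by linarith) hα₁0
  have hKα : 0 ≤ (K₁ + K₂) * α₁ := mul_nonneg (add_nonneg hK₁ hK₂) hα₁0
  refine ⟨T₂, hT₂l, hT₂r, h368, ?_, fun k => ?_, fun l => ?_, fun k l => ?_, ?_, fun k => ?_, fun l => ?_, fun k l => ?_⟩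
  · exact hasKernelBound_mono (g := toB6 g Rr H) _ hv hP1 fun a a' => mul_le_mul_of_nonneg_right hK1 (Real.exp_nonneg _)
  · exact hasKernelBound_mono (g := toB6 g Rr H) _ hv (hP2 k) fun a a' =>
      mul_le_mul_of_nonneg_right (mul_le_mul_of_nonneg_right hK1 (hw1 a)) (Real.exp_nonneg _)
  · exact hasKernelBound_mono (g := toB6 g Rr H) _ hv (hP3 l) fun a a' =>
      mul_le_mul_of_nonneg_right (mul_le_mul_of_nonneg_right hK1 (hw1 a)) (Real.exp_nonneg _)
  · exact hasKernelBound_mono (g := toB6 g Rr H) _ hv (hP4 k l) fun a a' =>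
      mul_le_mul_of_nonneg_right (mul_le_mul_of_nonneg_right hK1 (hw2 a)) (Real.exp_nonneg _)
  · exact hasKernelBound_mono (g := toB6 g Rr H) _ hv hQ1 fun a a' => mul_le_mul hK12 (hexp a a') (Real.exp_pos _).le hKα
  · exact hasKernelBound_mono (g := toB6 g Rr H) _ hv (hQ2 k) fun a a' =>
      mul_le_mul (mul_le_mul_of_nonneg_right hK12 (hw1 a)) (hexp a a') (Real.exp_pos _).le (mul_nonneg hKα (hw1 a))
  · exact hasKernelBound_mono (g := toB6 g Rr H) _ hv (hQ3 l) fun a a' =>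
      mul_le_mul (mul_le_mul_of_nonneg_right hK12 (hw1 a)) (hexp a a') (Real.exp_pos _).le (mul_nonneg hKα (hw1 a))
  · exact hasKernelBound_mono (g := toB6 g Rr H) _ hv (hQ4 k l) fun a a' =>
      mul_le_mul (mul_le_mul_of_nonneg_right hK12 (hw2 a)) (hexp a a') (Real.exp_pos _).le (mul_nonneg hKα (hw2 a))


end Capstone

end Literature.MathematicalPhysics.QuantumFieldTheory.Balaban1983to89.B9Thm34PPrimeKernelFinal

end
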